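import Literature.Topology.PlaneTopology.ChartParity
import Literature.Topology.PlaneTopology.ArgumentIncrement
import Literature.Topology.PlaneTopology.ArcLoops
import Mathlib.Topology.Algebra.Order.Floor
import HarnessLib

/-!
# Crossing parity of a cut by paths inside a swept Jordan curve

Topic: Topology / PlaneTopology. PROOFS ONLY (no definition of a named fact, no `sorry`).

Let `γ, γ'` be Jordan loops in `ℂ \ {0}` joined by a homotopy of (not necessarily simple) loops
`H τ` in `ℂ \ {0}`, and let `A ∋ 0` be a connected unbounded set missing `γ` (a "cut" from the
branch point `0` to `∞`). Then every path `λ` *inside `γ'`* whose two endpoints are not swept by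
the homotopy crosses the cut an **even** number of times: for every return path `ν` from `λ 1`
to `λ 0` avoiding `A`, the loop `λ ∗ ν` has even winding number about `0`
(`even_wind_concatPath_of_loopHomotopy`). Since `0` and `∞` lie on the same side of `γ`, this is
the statement that "a Jordan domain and a sweep-small perturbation of it let through the same
parity of crossings of a cut lying on the other side" — the topological core of the transfer of
crossing events between two percolation configurations whose interface loops are uniformly
close (`Literature.Probability.Percolation.dkkmo_crossing_rotation_invariance`, hypothesis `H` of
`dkkmo_crossing_rotation_invariance_of_transfer`): no assumption of "fatness", reach, or absence
of necks of the curves is needed.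

## The argument (square roots instead of the double cover)

The classical proof passes to the two-sheeted cover of the sphere branched at the ends `0, ∞` of
the cut; we run it with continuous square roots. Because `0` is outside `γ`, the loop `γ` has a
continuous logarithm, hence a continuous square root `X₀` — a Jordan loop again — and the
homotopy lifts to a homotopy of loops `X_τ = exp(ℒ_τ/2)` ending at a square root `X₁` of `γ'`
(`ℒ` a logarithm of `H` on the parameter square). **Squaring lemma** (`sq_image_inside`): for an
antipode-free Jordan loop `X` in `ℂ \ {0}` of winding number `0`, squaring is injective on the
closed inside of `X` and maps the inside of `X` onto the inside of `X²` (read off winding numbers: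
`wind(X² - w²) = wind(X - w) + wind(X + w)` and `-w` is outside when `w` is inside — antipodal
inside points would give a loop `p ∗ (-p)` of odd winding number inside the simply connected
closed inside, on which `z ↦ z` has a logarithm). So `λ` lifts to a path `λ̃` inside `X₁` with
`λ̃² = λ`; its endpoints are inside `X₁`, and — the endpoints of `λ` being unswept — the homotopy
`X_τ` shows their winding numbers with respect to `X₀` equal those with respect to `X₁`, hence
non-zero: **both lifted endpoints are inside `X₀`**. Join them inside `X₀`; the image `ν₀` of that
path under squaring is a return path inside `γ`, which misses `A`, and `λ ∗ ν₀ = (λ̃ ∗ ν̃)²` has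
even winding number; any other return path `ν` missing `A` differs from `ν₀` by a loop missing
the connected unbounded set `A ∋ 0`, of winding number `0`.

## Contents

* `logInc_concatPath`, `logInc_neg`, `logInc_sq`, `wind_concatPath_mul` — the increment of the
  logarithm (`logInc`, `ArgumentIncrement.lean`) along concatenations (`concatPath`,
  `ArcLoops.lean`), antipodal paths and squares;
* `hasLogOn_sub_of_not_isBounded`, `wind_eq_zero_of_forall_not_mem` — `z - a` has a logarithm
  on a compact set when `a` lies in the unbounded complementary component; a loop missing a
  preconnected unbounded set through `0` has winding number `0`;
* `IsJordanLoop`, `IsJordanLoop.inside`/`outside`, `mem_inside_iff_wind_ne_zero`,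
  `mem_outside_iff_wind_eq_zero`, `isOpen_inside`, `isPreconnected_inside`,
  `inside_eq_connectedComponentIn`, `subset_inside_or_subset_outside`, `joinedIn_inside`;
* `IsJordanLoop.neg_mem_outside` (antipodes of curve points are outside an antipode-free loop),
  `IsJordanLoop.neg_not_mem_inside` (its inside is antipode-free when `0` is outside), the
  squaring lemma `IsJordanLoop.sq_image_inside` and the lift `IsJordanLoop.exists_lift_sq`;
* `isJordanLoop_comp_fract_of_sq` — square roots of Jordan loops are Jordan loops (periodised
  by `∘ Int.fract`, cf. `ArcLoops`);
* `even_wind_concatPath_of_loopHomotopy` — the theorem (branch points `0` and `∞`);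
* `crossRatioFn_sub_crossRatioFn`, `crossRatioFn_injective`, `wind_crossRatioFn_sub`,
  `not_isBounded_image_crossRatioFn_cut`
  and `even_wind_sub_wind_of_loopHomotopy` — the same with finite branch points `P₀ ≠ P₁`
  (conjugate by `z ↦ (z - P₀)/(z - P₁)`): for a path `λ` off `Γ'` on the other side of `Γ'`
  than `P₀` (different winding numbers) with unswept endpoints and a return path `ν` missing the
  cut, `wind (λ ∗ ν - P₀) - wind (λ ∗ ν - P₁)` is even.

## References

* S. Eilenberg, Fund. Math. 26 (1936) (separation by continuous logarithms) [Eilenberg1936].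
* J. McCleary, *A First Course in Topology* (2006), Ch. 9 [Mccleary2006].
* C. Garban, G. Pete, O. Schramm, *Pivotal, cluster and interface measures for critical planar
  percolation*, JAMS 26 (2013), §2.3 (quad crossings are determined by the interface loops; the
  present statement is a deterministic discrete substitute for the continuum argument there)
  [GarbanPeteSchramm2013Pivotal].
-/

noncomputable section

namespace Literature.Topology.PlaneTopology

open Complex Set Filter Metric Bornology Function
open _root_.Topology
open scoped Real

/-! ### Concatenation of `[0,1]`-paths and argument increments -/

/-- Post-composition commutes with concatenation. [folklore] -/
theorem comp_concatPath (F : ℂ → ℂ) (f g : ℝ → ℂ) : F ∘ concatPath f g = concatPath (F ∘ f) (F ∘ g) := by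
  funext t
  by_cases ht : t ≤ 1 / 2
  · simp only [Function.comp_apply, concatPath_of_le_half ht]
  · simp only [Function.comp_apply, concatPath_of_half_lt (not_le.1 ht)]

/-- `t ↦ 2t` is continuous. [folklore] -/
private theorem continuous_two_mul : Continuous fun t : ℝ => 2 * t := by fun_prop

/-- `t ↦ 2t - 1` is continuous. [folklore] -/
private theorem continuous_two_mul_sub_one : Continuous fun t : ℝ => 2 * t - 1 := by fun_prop

/-- The concatenation of two paths continuous on `[0, 1]` that match (`f 1 = g 0`) is continuous
on `[0, 1]`. [folklore] -/
theorem continuousOn_concatPath {f g : ℝ → ℂ} (hf : ContinuousOn f (Icc 0 1))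
    (hg : ContinuousOn g (Icc 0 1)) (hfg : f 1 = g 0) : ContinuousOn (concatPath f g) (Icc 0 1) := by
  have h1 : ContinuousOn (concatPath f g) (Icc 0 (1 / 2)) := by
    refine (hf.comp continuous_two_mul.continuousOn ?_).congr ?_
    · intro t ht
      exact ⟨by nlinarith [ht.1], by nlinarith [ht.2]⟩
    · intro t ht
      exact concatPath_of_le_half ht.2
  have h2 : ContinuousOn (concatPath f g) (Icc (1 / 2) 1) := by
    refine (hg.comp continuous_two_mul_sub_one.continuousOn ?_).congr ?_
    · intro t ht
      exact ⟨by nlinarith [ht.1], by nlinarith [ht.2]⟩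
    · intro t ht
      rcases ht.1.eq_or_lt with rfl | h
      · show concatPath f g (1 / 2) = g (2 * (1 / 2) - 1)
        rw [concatPath_of_le_half le_rfl]
        norm_num [hfg]
      · exact concatPath_of_half_lt h
  have : Icc (0 : ℝ) 1 = Icc 0 (1 / 2) ∪ Icc (1 / 2) 1 := by
    rw [Icc_union_Icc_eq_Icc] <;> norm_num
  rw [this]
  exact h1.union_of_isClosed h2 isClosed_Icc isClosed_Icc

/-- A concatenation of paths in `S` stays in `S`. [folklore] -/
theorem mapsTo_concatPath {f g : ℝ → ℂ} {S : Set ℂ} (hf : MapsTo f (Icc 0 1) S)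
    (hg : MapsTo g (Icc 0 1) S) : MapsTo (concatPath f g) (Icc 0 1) S := by
  intro t ht
  by_cases h : t ≤ 1 / 2
  · rw [concatPath_of_le_half h]
    exact hf ⟨by linarith [ht.1], by linarith⟩
  · rw [concatPath_of_half_lt (not_le.1 h)]
    exact hg ⟨by linarith [not_le.1 h], by linarith [ht.2]⟩

/-- A path in `ℂ \ {0}` read on `[0, 1]`: continuous and nonvanishing there. [folklore] -/
structure IsNVPath (f : ℝ → ℂ) : Prop where
  continuousOn : ContinuousOn f (Icc 0 1)
  ne_zero : ∀ t ∈ Icc (0 : ℝ) 1, f t ≠ 0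

/-- A path in `ℂ \\ {0}` has a continuous logarithm. [folklore] -/
theorem IsNVPath.hasLogOn {f : ℝ → ℂ} (hf : IsNVPath f) : HasLogOn f (Icc 0 1) :=
  hasLogOn_Icc hf.continuousOn hf.ne_zero

/-- A loop in `ℂ \\ {0}` is a path in `ℂ \\ {0}`. [folklore] -/
theorem IsNonvanishingLoop.isNVPath {f : ℝ → ℂ} (hf : IsNonvanishingLoop f) : IsNVPath f :=
  ⟨hf.continuousOn, hf.ne_zero⟩

/-- Concatenation of paths in `ℂ \\ {0}`. [folklore] -/
theorem IsNVPath.concatPath {f g : ℝ → ℂ} (hf : IsNVPath f) (hg : IsNVPath g) (hfg : f 1 = g 0) :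
    IsNVPath (concatPath f g) :=
  ⟨continuousOn_concatPath hf.continuousOn hg.continuousOn hfg,
    fun _ ht => mapsTo_concatPath (S := {z | z ≠ 0}) hf.ne_zero hg.ne_zero ht⟩

/-- The increment along `-f` equals that along `f`. [folklore] -/
theorem logInc_neg {f : ℝ → ℂ} (hf : IsNVPath f) : logInc (fun t => -f t) = logInc f := by
  obtain ⟨l, hl, hle⟩ := hf.hasLogOn
  rw [logInc_eq hl hle, logInc_eq (l := fun t => l t + π * I) (hl.add continuousOn_const)
    fun t ht => by rw [exp_add, hle t ht, exp_pi_mul_I]; ring]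
  ring

/-- The increment along `f²` is twice that along `f`. [folklore] -/
theorem logInc_sq {f : ℝ → ℂ} (hf : IsNVPath f) : logInc (fun t => f t ^ 2) = 2 * logInc f := by
  obtain ⟨l, hl, hle⟩ := hf.hasLogOn
  rw [logInc_eq hl hle, logInc_eq (l := fun t => 2 * l t) (continuousOn_const.mul hl)
    fun t ht => by rw [← hle t ht, ← exp_nat_mul]; norm_num]
  ring

/-- **Additivity under concatenation.** [folklore] -/
theorem logInc_concatPath {f g : ℝ → ℂ} (hf : IsNVPath f) (hg : IsNVPath g) (hfg : f 1 = g 0) :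
    logInc (concatPath f g) = logInc f + logInc g := by
  obtain ⟨l, hl, hle⟩ := hf.hasLogOn
  obtain ⟨m, hm, hme⟩ := hg.hasLogOn
  set c : ℂ := l 1 - m 0 with hc
  have hec : exp c = 1 := by
    rw [hc, exp_sub, hle 1 one_mem_Icc01, hme 0 zero_mem_Icc01, hfg, div_self (hg.ne_zero 0 zero_mem_Icc01)]
  -- the glued logarithm
  set L : ℝ → ℂ := fun t => if t ≤ 1 / 2 then l (2 * t) else m (2 * t - 1) + c with hL
  have hL1 : ContinuousOn L (Icc 0 (1 / 2)) := by
    refine (hl.comp continuous_two_mul.continuousOn ?_).congr ?_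
    · intro t ht; exact ⟨by nlinarith [ht.1], by nlinarith [ht.2]⟩
    · intro t ht
      show L t = l (2 * t)
      simp only [hL]
      rw [if_pos ht.2]
  have hL2 : ContinuousOn L (Icc (1 / 2) 1) := by
    refine ((hm.comp continuous_two_mul_sub_one.continuousOn ?_).add
      (continuousOn_const (c := c))).congr ?_
    · intro t ht; exact ⟨by nlinarith [ht.1], by nlinarith [ht.2]⟩
    · intro t ht
      show L t = m (2 * t - 1) + c
      simp only [hL]
      rcases ht.1.eq_or_lt with rfl | h
      · rw [if_pos le_rfl, hc]
        norm_num
      · rw [if_neg (not_le.2 h)]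
  have hLc : ContinuousOn L (Icc 0 1) := by
    have : Icc (0 : ℝ) 1 = Icc 0 (1 / 2) ∪ Icc (1 / 2) 1 := by
      rw [Icc_union_Icc_eq_Icc] <;> norm_num
    rw [this]
    exact hL1.union_of_isClosed hL2 isClosed_Icc isClosed_Icc
  have hLe : ∀ t ∈ Icc (0 : ℝ) 1, exp (L t) = concatPath f g t := by
    intro t ht
    by_cases h : t ≤ 1 / 2
    · show exp (L t) = _
      simp only [hL]
      rw [if_pos h, concatPath_of_le_half h]
      exact hle _ ⟨by linarith [ht.1], by linarith⟩
    · show exp (L t) = _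
      simp only [hL]
      rw [if_neg h, concatPath_of_half_lt (not_le.1 h), exp_add, hec, mul_one]
      exact hme _ ⟨by linarith [not_le.1 h], by linarith [ht.2]⟩
  have hL1v : L 1 = m 1 + c := by
    show (if (1 : ℝ) ≤ 1 / 2 then l (2 * 1) else m (2 * 1 - 1) + c) = m 1 + c
    rw [if_neg (by norm_num)]
    norm_num
  have hL0v : L 0 = l 0 := by
    show (if (0 : ℝ) ≤ 1 / 2 then l (2 * 0) else m (2 * 0 - 1) + c) = l 0
    rw [if_pos (by norm_num)]
    norm_num
  rw [logInc_eq hLc hLe, logInc_eq hl hle, logInc_eq hm hme, hL1v, hL0v, hc]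
  ring

/-- **Winding number of a concatenated loop.** [folklore] -/
theorem wind_concatPath_mul {f g : ℝ → ℂ} (hf : IsNVPath f) (hg : IsNVPath g) (hfg : f 1 = g 0)
    (hgf : g 1 = f 0) :
    (wind (concatPath f g) : ℂ) * (2 * π * I) = logInc f + logInc g := by
  have hloop : IsNonvanishingLoop (concatPath f g) :=
    { (hf.concatPath hg hfg) with
      eq_endpoints := by rw [concatPath_zero, concatPath_one, hgf] }
  rw [(logInc_eq_wind_mul hloop).symm, logInc_concatPath hf hg hfg]

/-! ### Logarithms of `z - a` for `a` in the unbounded component -/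

/-- If `a ∉ K`, `K` compact, and the component of `a` in `ℂ \ K` is unbounded, then `z ↦ z - a`
has a continuous logarithm on `K`: write `z - a = ((z - a)/(z - c)) · (z - c)` with `c` a far
point of that component (Eilenberg's criterion for the first factor, the principal branch for
the second). [cite: Eilenberg1936] -/
theorem hasLogOn_sub_of_not_isBounded {K : Set ℂ} (hK : IsCompact K) {a : ℂ}
    (hU : ¬ IsBounded (connectedComponentIn Kᶜ a)) : HasLogOn (fun z => z - a) K := by
  obtain ⟨R, hR⟩ := (isBounded_iff_subset_closedBall a).1 hK.isBounded
  obtain ⟨c, hcU, hcR⟩ : ∃ c ∈ connectedComponentIn Kᶜ a, max R 0 < dist c a := by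
    by_contra h
    push Not at h
    exact hU ((isBounded_iff_subset_closedBall a).2 ⟨max R 0, fun z hz => h z hz⟩)
  have hcK : c ∉ K := fun h => connectedComponentIn_subset _ _ hcU h
  have hac : a - c ≠ 0 := by
    intro h
    rw [sub_eq_zero.1 h, dist_self] at hcR
    exact (lt_irrefl _ ((le_max_right R 0).trans_lt hcR)).elim
  have h1 : HasLogOn (fun z => (z - a) / (z - c)) K :=
    hasLogOn_div_sub_of_mem_connectedComponentIn hK.isClosed hcU
  have h2 : HasLogOn (fun z => z - c) K := by
    refine hasLogOn_of_norm_sub_lt (g := fun _ => a - c) (by fun_prop) (hasLogOn_const hac K) ?_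
    intro z hz
    have hza : dist z a ≤ R := hR hz
    calc ‖z - c - (a - c)‖ = dist z a := by rw [dist_eq_norm]; ring_nf
      _ < dist c a := (hza.trans (le_max_left R 0)).trans_lt hcR
      _ = ‖a - c‖ := by rw [dist_comm, dist_eq_norm]
  refine (h1.mul h2).congr fun z hz => ?_
  have hzc : z - c ≠ 0 := sub_ne_zero.2 fun h => hcK (h ▸ hz)
  simp only [div_mul_cancel₀ _ hzc]

/-- A set `A` that is preconnected, unbounded and misses `K` lies in an unbounded component of
`ℂ \ K`. [folklore] -/
theorem not_isBounded_connectedComponentIn_of_subset {K A : Set ℂ} (hA : IsPreconnected A)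
    (hAK : A ⊆ Kᶜ) (hAb : ¬ IsBounded A) {a : ℂ} (ha : a ∈ A) :
    ¬ IsBounded (connectedComponentIn Kᶜ a) :=
  fun h => hAb (h.subset (hA.subset_connectedComponentIn ha hAK))

/-- The winding number of a loop about a point of the unbounded component of its complement is
`0`. [folklore] -/
theorem wind_sub_eq_zero_of_not_isBounded {f : ℝ → ℂ} (hf : ContinuousOn f (Icc 0 1))
    (h01 : f 0 = f 1) {a : ℂ}
    (hU : ¬ IsBounded (connectedComponentIn (f '' Icc 0 1)ᶜ a)) : wind (fun t => f t - a) = 0 :=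
  wind_comp_eq_zero_of_hasLogOn (F := fun z => z - a)
    (hasLogOn_sub_of_not_isBounded (isCompact_Icc.image_of_continuousOn hf) hU) hf
    (mapsTo_image f _) h01

/-- **A loop missing a preconnected unbounded set through `0` has winding number `0`.** [folklore] -/
theorem wind_eq_zero_of_forall_not_mem {f : ℝ → ℂ} (hf : ContinuousOn f (Icc 0 1)) (h01 : f 0 = f 1)
    {A : Set ℂ} (hA : IsPreconnected A) (h0 : (0 : ℂ) ∈ A) (hAb : ¬ IsBounded A)
    (hfA : ∀ t ∈ Icc (0 : ℝ) 1, f t ∉ A) : wind f = 0 := by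
  have hsub : A ⊆ (f '' Icc 0 1)ᶜ := by
    rintro z hz ⟨t, ht, rfl⟩
    exact hfA t ht hz
  have h := wind_sub_eq_zero_of_not_isBounded hf h01 (a := 0)
    (not_isBounded_connectedComponentIn_of_subset hA hsub hAb h0)
  simpa only [sub_zero] using h

/-! ### Jordan loops: inside and outside, read on winding numbers -/

/-- A **Jordan loop**: a continuous `1`-periodic map `ℝ → ℂ` injective on `[0, 1)` (the
boundary datum of `Literature.Probability.RandomPlanarGeometry.JordanDomain`). [folklore] -/
structure IsJordanLoop (γ : ℝ → ℂ) : Prop where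
  continuous : Continuous γ
  periodic : Function.Periodic γ 1
  injOn : InjOn γ (Ico 0 1)

namespace IsJordanLoop

variable {γ : ℝ → ℂ}

/-- The range of a `1`-periodic loop is the image of `[0, 1]`. [folklore] -/
theorem range_eq_image (h : IsJordanLoop γ) : range γ = γ '' Icc 0 1 := by
  refine Subset.antisymm ?_ (image_subset_range _ _)
  rintro z ⟨t, rfl⟩
  obtain ⟨x, hx, hxt⟩ := h.periodic.exists_mem_Ico₀ one_pos t
  exact ⟨x, Ico_subset_Icc_self hx, hxt.symm⟩

/-- The range of a Jordan loop is compact. [folklore] -/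
theorem isCompact_range (h : IsJordanLoop γ) : IsCompact (range γ) := by
  rw [h.range_eq_image]
  exact isCompact_Icc.image h.continuous

/-- A Jordan loop closes up on `[0, 1]`. [folklore] -/
theorem eq_zero_one (h : IsJordanLoop γ) : γ 0 = γ 1 := by
  have := h.periodic 0
  rw [zero_add] at this
  exact this.symm

/-- The loop `γ - a` for `a` off the curve. [folklore] -/
theorem isNonvanishingLoop_sub (h : IsJordanLoop γ) {a : ℂ} (ha : a ∉ range γ) :
    IsNonvanishingLoop fun t => γ t - a :=
  ⟨(h.continuous.continuousOn).sub continuousOn_const,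
    fun t _ => sub_ne_zero.2 fun h' => ha ⟨t, h'⟩, by rw [h.eq_zero_one]⟩

/-- The **inside** of a Jordan loop: the points off the curve whose complementary component is
bounded. [folklore] -/
def inside (γ : ℝ → ℂ) : Set ℂ := {z | z ∉ range γ ∧ IsBounded (connectedComponentIn (range γ)ᶜ z)}

/-- The **outside** of a Jordan loop: the points off the curve whose complementary component is
unbounded. [folklore] -/
def outside (γ : ℝ → ℂ) : Set ℂ := {z | z ∉ range γ ∧ ¬ IsBounded (connectedComponentIn (range γ)ᶜ z)}

/-- A point off the curve is inside or outside. [folklore] -/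
theorem mem_inside_or_mem_outside {z : ℂ} (hz : z ∉ range γ) : z ∈ inside γ ∨ z ∈ outside γ := by
  by_cases hb : IsBounded (connectedComponentIn (range γ)ᶜ z)
  · exact Or.inl ⟨hz, hb⟩
  · exact Or.inr ⟨hz, hb⟩

/-- Inside and outside are disjoint. [folklore] -/
theorem disjoint_inside_outside : Disjoint (inside γ) (outside γ) :=
  Set.disjoint_left.2 fun _ hz hz' => hz'.2 hz.2

/-- **Inside ⇔ non-zero winding number.** [cite: Eilenberg1936] -/
theorem mem_inside_iff_wind_ne_zero (h : IsJordanLoop γ) {z : ℂ} (hz : z ∉ range γ) :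
    z ∈ inside γ ↔ wind (fun t => γ t - z) ≠ 0 := by
  constructor
  · rintro ⟨-, hb⟩ hw
    exact not_hasLogOn_sub h.isCompact_range hz hb
      ((hasLogOn_sub_range_iff_wind_eq_zero h.continuous h.periodic h.injOn hz).2 hw)
  · intro hw
    refine ⟨hz, ?_⟩
    by_contra hb
    exact hw ((hasLogOn_sub_range_iff_wind_eq_zero h.continuous h.periodic h.injOn hz).1
      (hasLogOn_sub_of_not_isBounded h.isCompact_range hb))

/-- **Outside ⇔ zero winding number** (off the curve). [cite: Eilenberg1936] -/
theorem mem_outside_iff_wind_eq_zero (h : IsJordanLoop γ) {z : ℂ} (hz : z ∉ range γ) :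
    z ∈ outside γ ↔ wind (fun t => γ t - z) = 0 := by
  rcases mem_inside_or_mem_outside hz with hi | ho
  · refine ⟨fun ho => (Set.disjoint_left.1 disjoint_inside_outside hi ho).elim, fun hw => ?_⟩
    exact (((h.mem_inside_iff_wind_ne_zero hz).1 hi) hw).elim
  · refine ⟨fun _ => ?_, fun _ => ho⟩
    by_contra hw
    exact Set.disjoint_left.1 disjoint_inside_outside ((h.mem_inside_iff_wind_ne_zero hz).2 hw) ho

/-- A preconnected unbounded set missing the curve lies outside. [folklore] -/
theorem subset_outside_of_isPreconnected {A : Set ℂ} (hA : IsPreconnected A)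
    (hAγ : A ⊆ (range γ)ᶜ) (hAb : ¬ IsBounded A) : A ⊆ outside γ := fun _ ha =>
  ⟨hAγ ha, not_isBounded_connectedComponentIn_of_subset hA hAγ hAb ha⟩

/-- The inside is one complementary component. [cite: Mccleary2006, Ch. 9] -/
theorem inside_eq_connectedComponentIn (h : IsJordanLoop γ) {z : ℂ} (hz : z ∈ inside γ) :
    inside γ = connectedComponentIn (range γ)ᶜ z := by
  obtain ⟨e, -⟩ := exists_homeomorph_addCircle_forall_eq h.continuous h.periodic h.injOn
  ext w
  constructor
  · intro hw
    by_contra hne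
    refine JordanCurveProof.not_isBounded_of_isBounded e hw.1 hz.1 hw.2 hz.2 fun heq => hne ?_
    rw [← heq]
    exact mem_connectedComponentIn hw.1
  · intro hw
    have hw' : w ∉ range γ := connectedComponentIn_subset _ _ hw
    refine ⟨hw', ?_⟩
    rw [← connectedComponentIn_eq hw]
    exact hz.2

/-- The outside is one complementary component. [folklore] -/
theorem outside_eq_connectedComponentIn (h : IsJordanLoop γ) {z : ℂ} (hz : z ∈ outside γ) :
    outside γ = connectedComponentIn (range γ)ᶜ z := by
  ext w
  constructor
  · intro hw
    rw [Janiszewski.connectedComponentIn_eq_of_not_isBounded h.isCompact_range hz.2 hw.2]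
    exact mem_connectedComponentIn hw.1
  · intro hw
    have hw' : w ∉ range γ := connectedComponentIn_subset _ _ hw
    refine ⟨hw', ?_⟩
    rw [← connectedComponentIn_eq hw]
    exact hz.2

/-- The inside is open. [folklore] -/
theorem isOpen_inside (h : IsJordanLoop γ) : IsOpen (inside γ) := by
  rcases (inside γ).eq_empty_or_nonempty with he | ⟨z, hz⟩
  · rw [he]; exact isOpen_empty
  · rw [h.inside_eq_connectedComponentIn hz]
    exact h.isCompact_range.isClosed.isOpen_compl.connectedComponentIn

/-- The outside is open. [folklore] -/
theorem isOpen_outside (h : IsJordanLoop γ) : IsOpen (outside γ) := by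
  rcases (outside γ).eq_empty_or_nonempty with he | ⟨z, hz⟩
  · rw [he]; exact isOpen_empty
  · rw [h.outside_eq_connectedComponentIn hz]
    exact h.isCompact_range.isClosed.isOpen_compl.connectedComponentIn

/-- The inside is preconnected. [folklore] -/
theorem isPreconnected_inside (h : IsJordanLoop γ) : IsPreconnected (inside γ) := by
  rcases (inside γ).eq_empty_or_nonempty with he | ⟨z, hz⟩
  · rw [he]; exact isPreconnected_empty
  · rw [h.inside_eq_connectedComponentIn hz]
    exact isPreconnected_connectedComponentIn

/-- The outside is preconnected. [folklore] -/
theorem isPreconnected_outside (h : IsJordanLoop γ) : IsPreconnected (outside γ) := by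
  rcases (outside γ).eq_empty_or_nonempty with he | ⟨z, hz⟩
  · rw [he]; exact isPreconnected_empty
  · rw [h.outside_eq_connectedComponentIn hz]
    exact isPreconnected_connectedComponentIn

/-- The inside is bounded. [folklore] -/
theorem isBounded_inside (h : IsJordanLoop γ) : IsBounded (inside γ) := by
  rcases (inside γ).eq_empty_or_nonempty with he | ⟨z, hz⟩
  · rw [he]; exact isBounded_empty
  · rw [h.inside_eq_connectedComponentIn hz]
    exact hz.2

/-- The closed inside is the inside together with the curve (at most). [folklore] -/
theorem closure_inside_subset (h : IsJordanLoop γ) : closure (inside γ) ⊆ inside γ ∪ range γ := by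
  rcases (inside γ).eq_empty_or_nonempty with he | ⟨z, hz⟩
  · rw [he, closure_empty]; exact empty_subset _
  · intro w hw
    rw [h.inside_eq_connectedComponentIn hz] at hw ⊢
    exact closure_connectedComponentIn_compl_subset h.isCompact_range.isClosed z hw

/-- The closed inside is compact. [folklore] -/
theorem isCompact_closure_inside (h : IsJordanLoop γ) : IsCompact (closure (inside γ)) :=
  Metric.isCompact_of_isClosed_isBounded isClosed_closure h.isBounded_inside.closure

/-- Inside points are joined inside. [folklore] -/
theorem joinedIn_inside (h : IsJordanLoop γ) {x y : ℂ} (hx : x ∈ inside γ) (hy : y ∈ inside γ) :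
    JoinedIn (inside γ) x y := by
  have hconn : IsConnected (inside γ) := ⟨⟨x, hx⟩, h.isPreconnected_inside⟩
  exact ((h.isOpen_inside.isConnected_iff_isPathConnected).1 hconn).joinedIn x hx y hy

end IsJordanLoop

/-! ### The squaring lemma -/

namespace IsJordanLoop

variable {X : ℝ → ℂ}

/-- A preconnected set missing the curve lies inside or outside. [folklore] -/
theorem subset_inside_or_subset_outside {γ : ℝ → ℂ} (h : IsJordanLoop γ) {A : Set ℂ}
    (hA : IsPreconnected A) (hAγ : A ⊆ (range γ)ᶜ) : A ⊆ inside γ ∨ A ⊆ outside γ := by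
  rcases A.eq_empty_or_nonempty with rfl | ⟨a, ha⟩
  · exact Or.inl (empty_subset _)
  have hsub : A ⊆ connectedComponentIn (range γ)ᶜ a := hA.subset_connectedComponentIn ha hAγ
  rcases mem_inside_or_mem_outside (hAγ ha) with hi | ho
  · exact Or.inl (by rw [h.inside_eq_connectedComponentIn hi]; exact hsub)
  · exact Or.inr (by rw [h.outside_eq_connectedComponentIn ho]; exact hsub)

/-- The antipodal loop of a Jordan loop is a Jordan loop. [folklore] -/
theorem neg (h : IsJordanLoop X) : IsJordanLoop fun t => -X t :=
  ⟨h.continuous.neg, fun t => by simp [h.periodic t], fun s hs t ht hst => h.injOn hs ht (neg_inj.1 hst)⟩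

/-- The range of the antipodal loop. [folklore] -/
theorem range_neg : range (fun t => -X t) = -range X := by
  ext z
  simp only [mem_range, Set.mem_neg]
  constructor
  · rintro ⟨t, rfl⟩; exact ⟨t, by simp⟩
  · rintro ⟨t, ht⟩; exact ⟨t, by rw [ht, neg_neg]⟩

/-- The winding number of `-f` is that of `f`. [folklore] -/
theorem _root_.Literature.Topology.PlaneTopology.wind_neg {f : ℝ → ℂ} (hf : IsNonvanishingLoop f) :
    wind (fun t => -f t) = wind f := by
  have := wind_mul (IsNonvanishingLoop.const (c := (-1 : ℂ)) (by norm_num)) hf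
  rw [wind_const, zero_add] at this
  rw [← this]
  exact wind_congr fun t _ => by simp

/-- Inside `-X` means: the antipode is inside `X`. [folklore] -/
theorem mem_inside_neg_iff (h : IsJordanLoop X) {z : ℂ} : z ∈ inside (fun t => -X t) ↔ -z ∈ inside X := by
  have hr : z ∉ range (fun t => -X t) ↔ -z ∉ range X := by
    rw [range_neg]
    exact Iff.not ⟨fun hz => by simpa using hz, fun hz => by simpa using hz⟩
  constructor
  · intro hz
    have hz' : -z ∉ range X := hr.1 hz.1
    rw [h.neg.mem_inside_iff_wind_ne_zero hz.1] at hz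
    rw [h.mem_inside_iff_wind_ne_zero hz']
    rwa [show (fun t => -X t - z) = fun t => -(X t - -z) by funext t; ring,
      wind_neg (h.isNonvanishingLoop_sub hz')] at hz
  · intro hz
    have hzr : -z ∉ range X := hz.1
    have hz' : z ∉ range (fun t => -X t) := hr.2 hzr
    rw [h.mem_inside_iff_wind_ne_zero hzr] at hz
    rw [h.neg.mem_inside_iff_wind_ne_zero hz',
      show (fun t => -X t - z) = fun t => -(X t - -z) by funext t; ring,
      wind_neg (h.isNonvanishingLoop_sub hzr)]
    exact hz

section Antipode

variable (h : IsJordanLoop X) (hanti : ∀ s t, X s ≠ -X t)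
include h hanti

omit h in
/-- An antipode-free loop does not vanish. [folklore] -/
theorem ne_zero_of_antipode (t : ℝ) : X t ≠ 0 := fun h0 => hanti t t (by rw [h0, neg_zero])

omit h in
/-- `0` is off an antipode-free loop. [folklore] -/
theorem zero_not_mem_range : (0 : ℂ) ∉ range X := by
  rintro ⟨t, ht⟩
  exact ne_zero_of_antipode hanti t ht

/-- The squared loop of an antipode-free Jordan loop is a Jordan loop. [folklore] -/
theorem sq : IsJordanLoop fun t => X t ^ 2 :=
  ⟨h.continuous.pow 2, fun t => by simp [h.periodic t], fun s hs t ht hst => by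
    rcases sq_eq_sq_iff_eq_or_eq_neg.1 hst with h1 | h1
    · exact h.injOn hs ht h1
    · exact (hanti s t h1).elim⟩

/-- **Antipodes of curve points are outside.** The farthest point `X t₀` of the curve has its
antipode on a ray to `∞` missing the curve; the other antipodes are joined to it along `-X`.
[folklore] -/
theorem neg_mem_outside (t : ℝ) : -X t ∈ outside X := by
  -- reduce to `t ∈ [0, 1]`
  obtain ⟨t₁, ht₁, ht₁t⟩ := h.periodic.exists_mem_Ico₀ one_pos t
  rw [ht₁t]
  clear ht₁t t
  -- the farthest point
  obtain ⟨t₀, ht₀, hmax⟩ := isCompact_Icc.exists_isMaxOn (nonempty_Icc.2 zero_le_one)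
    (h.continuous.norm.continuousOn : ContinuousOn (fun t => ‖X t‖) (Icc 0 1))
  set M : ℝ := ‖X t₀‖ with hM
  have hM0 : 0 < M := norm_pos_iff.2 (ne_zero_of_antipode hanti t₀)
  -- the ray from `-X t₀` to infinity and the antipodal curve
  set ray : ℝ → ℂ := fun r => -(((1 + r : ℝ) : ℂ) * X t₀) with hray
  set T : Set ℂ := ray '' Ici 0 ∪ (fun t => -X t) '' Icc 0 1 with hT
  have hnorm : ∀ r, 0 ≤ r → ‖ray r‖ = (1 + r) * M := fun r hr => by
    simp only [hray, norm_neg, norm_mul, Complex.norm_real, Real.norm_eq_abs,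
      abs_of_nonneg (by linarith : (0 : ℝ) ≤ 1 + r), hM]
  have hTc : T ⊆ (range X)ᶜ := by
    rintro z (⟨r, hr, rfl⟩ | ⟨s, -, rfl⟩) ⟨u, hu⟩
    · -- `X u = ray r`: norms force `r = 0`, then an antipode
      obtain ⟨u₁, hu₁, hu₁u⟩ := h.periodic.exists_mem_Ico₀ one_pos u
      have hle : ‖X u‖ ≤ M := by rw [hu₁u]; exact hmax (Ico_subset_Icc_self hu₁)
      rw [hu, hnorm r hr] at hle
      have hr0 : r = 0 := le_antisymm (by nlinarith) hr
      rw [hr0] at hu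
      refine hanti u t₀ ?_
      rw [hu, hray]
      norm_num
    · exact hanti u s hu
  have hTpre : IsPreconnected T := by
    have hmeet : (ray '' Ici 0 ∩ (fun t => -X t) '' Icc 0 1).Nonempty :=
      ⟨-X t₀, ⟨0, Set.mem_Ici.2 le_rfl, by simp [hray]⟩, ⟨t₀, ht₀, rfl⟩⟩
    obtain ⟨z, hz1, hz2⟩ := hmeet
    refine IsPreconnected.union z hz1 hz2 ?_ ?_
    · exact isPreconnected_Ici.image _ (by fun_prop)
    · exact isPreconnected_Icc.image _ h.continuous.neg.continuousOn
  have hTb : ¬ IsBounded T := by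
    intro hb
    obtain ⟨R, hR⟩ := (isBounded_iff_subset_closedBall 0).1 hb
    -- the ray point with `(1 + r) M = max R 0 + M + 1`
    set r : ℝ := (max R 0 + 1) / M with hr
    have hr0 : 0 ≤ r := by positivity
    have hmem : ray r ∈ T := Or.inl ⟨r, hr0, rfl⟩
    have := hR hmem
    rw [mem_closedBall, dist_zero_right, hnorm r hr0] at this
    have h2 : (1 + r) * M = M + (max R 0 + 1) := by
      rw [hr]; field_simp
    rw [h2] at this
    linarith [le_max_left R 0]
  refine ⟨fun hmem => hTc (Or.inr ⟨t₁, Ico_subset_Icc_self ht₁, rfl⟩) hmem, ?_⟩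
  exact not_isBounded_connectedComponentIn_of_subset hTpre hTc hTb
    (Or.inr ⟨t₁, Ico_subset_Icc_self ht₁, rfl⟩)

/-- Antipodes of points of the curve are off the closed inside. [folklore] -/
theorem neg_not_mem_inside_of_mem_range {w : ℂ} (hw : w ∈ range X) : -w ∉ inside X := by
  obtain ⟨t, rfl⟩ := hw
  exact fun hi => Set.disjoint_left.1 disjoint_inside_outside hi (neg_mem_outside h hanti t)

variable (h0 : (0 : ℂ) ∈ outside X)
include h0

/-- **The inside is antipode-free**: if `w` is inside then `-w` is not. The insides of the
disjoint Jordan loops `X`, `-X` (each missing the other's curve, by `neg_mem_outside`) are nested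
or disjoint; nested forces `inside X = -inside X`, and then a path `p` inside from `w` to `-w`
gives the loop `p ∗ (-p)` inside, of odd winding number about `0` — impossible, `z ↦ z` having a
logarithm on the closed inside (`0` is outside). [folklore] -/
theorem neg_not_mem_inside {w : ℂ} (hw : w ∈ inside X) : -w ∉ inside X := by
  intro hw'
  have hXn : IsJordanLoop fun t => -X t := h.neg
  -- `inside (-X) = -(inside X)` misses `range X`, hence lies inside or outside `X`
  have hIn : inside (fun t => -X t) ⊆ (range X)ᶜ := by
    intro z hz hzr
    have : -z ∈ inside X := (h.mem_inside_neg_iff).1 hz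
    exact neg_not_mem_inside_of_mem_range h hanti hzr this
  have hIX : inside X ⊆ (range fun t => -X t)ᶜ := by
    intro z hz hzr
    rw [range_neg] at hzr
    have hzr' : -z ∈ range X := by simpa using hzr
    have := neg_not_mem_inside_of_mem_range h hanti hzr'
    rw [neg_neg] at this
    exact this hz
  have hwn : w ∈ inside fun t => -X t := (h.mem_inside_neg_iff).2 (by simpa using hw')
  have hwn' : -w ∈ inside fun t => -X t := (h.mem_inside_neg_iff).2 (by simpa using hw)
  rcases h.subset_inside_or_subset_outside hXn.isPreconnected_inside hIn with h1 | h1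
  · rcases hXn.subset_inside_or_subset_outside h.isPreconnected_inside hIX with h2 | h2
    · -- `inside X = inside (-X) = -(inside X)`: the odd loop
      set V := inside X with hV
      have hVneg : ∀ z ∈ V, -z ∈ V := fun z hz => by
        have := h2 hz
        rw [h.mem_inside_neg_iff] at this
        exact this
      -- `z ↦ z` has a logarithm on the closed inside
      have hK : IsCompact (closure V) := h.isCompact_closure_inside
      have h0K : (0 : ℂ) ∉ closure V := fun h0c => by
        rcases h.closure_inside_subset h0c with h0i | h0r
        · exact Set.disjoint_left.1 disjoint_inside_outside h0i h0
        · exact h0.1 h0r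
      have hout : outside X ⊆ (closure V)ᶜ := by
        intro z hz hzc
        rcases h.closure_inside_subset hzc with hzi | hzr
        · exact Set.disjoint_left.1 disjoint_inside_outside hzi hz
        · exact hz.1 hzr
      have hU : ¬ IsBounded (connectedComponentIn (closure V)ᶜ 0) :=
        not_isBounded_connectedComponentIn_of_subset h.isPreconnected_outside hout
          (fun hb => h0.2 (hb.subset (by
            rw [h.outside_eq_connectedComponentIn h0]))) h0
      have hlog : HasLogOn (fun z : ℂ => z) (closure V) :=
        (hasLogOn_sub_of_not_isBounded hK hU).congr fun z _ => by simp
      -- the path `p` from `w` to `-w` inside, and the loop `p ∗ (-p)`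
      obtain ⟨p, hp⟩ : ∃ p : Path w (-w), ∀ t, p t ∈ V :=
        ⟨(h.joinedIn_inside hw hw').somePath, (h.joinedIn_inside hw hw').somePath_mem⟩
      set f : ℝ → ℂ := fun t => p.extend t with hf
      have hfV : ∀ t, f t ∈ V := fun t => by
        obtain ⟨u, hu⟩ : f t ∈ range p := by rw [← Path.extend_range p]; exact mem_range_self t
        rw [← hu]
        exact hp u
      have hfc : Continuous f := p.continuous_extend
      have hf0 : ∀ t, f t ≠ 0 := fun t hft => h0K (subset_closure (hft ▸ hfV t))
      have hfP : IsNVPath f := ⟨hfc.continuousOn, fun t _ => hf0 t⟩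
      have hnfP : IsNVPath fun t => -f t := ⟨hfc.neg.continuousOn, fun t _ => neg_ne_zero.2 (hf0 t)⟩
      have hf1 : f 1 = -w := p.extend_one
      have hf0' : f 0 = w := p.extend_zero
      set q : ℝ → ℂ := concatPath f fun t => -f t with hq
      have hqK : MapsTo q (Icc 0 1) (closure V) :=
        mapsTo_concatPath (fun t _ => subset_closure (hfV t))
          (fun t _ => subset_closure (hVneg _ (hfV t)))
      have hq01 : q 0 = q 1 := by
        rw [hq, concatPath_zero, concatPath_one, hf1, neg_neg, hf0']
      have hwind0 : wind q = 0 :=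
        wind_comp_eq_zero_of_hasLogOn (F := fun z : ℂ => z) hlog
          (continuousOn_concatPath hfc.continuousOn hfc.neg.continuousOn (by
            show f 1 = -f 0
            rw [hf1, hf0'])) hqK hq01
      -- but the increment is odd
      obtain ⟨l, hl, hle⟩ := hfP.hasLogOn
      have hinc : logInc f = l 1 - l 0 := logInc_eq hl hle
      obtain ⟨n, hn⟩ : ∃ n : ℤ, l 1 - l 0 = π * I + n * (2 * π * I) := by
        have h1 : exp (l 1 - l 0) = exp (π * I) := by
          rw [exp_sub, hle 1 one_mem_Icc01, hle 0 zero_mem_Icc01, hf1, hf0', exp_pi_mul_I, neg_div,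
            div_self (fun h' => h0K (subset_closure (h' ▸ hw)))]
        obtain ⟨n, hn⟩ := exp_eq_exp_iff_exists_int.1 h1
        exact ⟨n, hn⟩
      have hwq := wind_concatPath_mul hfP hnfP (by rw [hf1, hf0']) (by
        show -f 1 = f 0
        rw [hf1, hf0', neg_neg])
      rw [logInc_neg hfP, hinc, hn, hwind0] at hwq
      have h2 : (2 * π * I : ℂ) ≠ 0 := by simp [Real.pi_ne_zero, I_ne_zero]
      have : ((0 : ℤ) : ℂ) * (2 * π * I) = (2 * n + 1) * (2 * π * I) := by rw [hwq]; ring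
      have h3 := mul_right_cancel₀ h2 this
      have h4 : ((2 * n + 1 : ℤ) : ℂ) = 0 := by push_cast; rw [← h3]; simp
      norm_cast at h4
      omega
    · -- `inside X ⊆ outside (-X)` but `w ∈ inside X` is inside `-X`
      exact Set.disjoint_left.1 disjoint_inside_outside hwn (h2 hw)
  · -- `inside (-X) ⊆ outside X` but `-w ∈ inside (-X) ∩ inside X`
    exact Set.disjoint_left.1 disjoint_inside_outside hw' (h1 hwn')

end Antipode

end IsJordanLoop

namespace IsJordanLoop

section Squaring

variable {X : ℝ → ℂ} (h : IsJordanLoop X) (hanti : ∀ s t, X s ≠ -X t)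
include h

/-- Winding numbers about a square factor. [folklore] -/
theorem wind_sq_sub_sq {w : ℂ} (hw : w ∉ range X) (hw' : -w ∉ range X) :
    wind (fun t => X t ^ 2 - w ^ 2) = wind (fun t => X t - w) + wind (fun t => X t - -w) := by
  have e : (fun t => X t ^ 2 - w ^ 2) = fun t => (X t - w) * (X t - -w) := by funext t; ring
  rw [e, wind_mul (h.isNonvanishingLoop_sub hw) (h.isNonvanishingLoop_sub hw')]

omit h in
/-- Squares of points off `X ∪ -X` are off `X²`. [folklore] -/
theorem sq_not_mem_range_sq {w : ℂ} (hw : w ∉ range X) (hw' : -w ∉ range X) :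
    w ^ 2 ∉ range (fun t => X t ^ 2) := by
  rintro ⟨t, ht⟩
  rcases sq_eq_sq_iff_eq_or_eq_neg.1 ht with h1 | h1
  · exact hw ⟨t, h1⟩
  · exact hw' ⟨t, h1⟩

include hanti

/-- Antipodes of inside points are outside (for an antipode-free loop with `0` outside).
[folklore] -/
theorem neg_mem_outside_of_mem_inside (h0 : (0 : ℂ) ∈ outside X) {w : ℂ} (hw : w ∈ inside X) :
    -w ∈ outside X := by
  have hwr : -w ∉ range X := fun hr => by
    have := neg_not_mem_inside_of_mem_range h hanti hr
    rw [neg_neg] at this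
    exact this hw
  rcases mem_inside_or_mem_outside hwr with hi | ho
  · exact (neg_not_mem_inside h hanti h0 hw hi).elim
  · exact ho

/-- Squares of inside points are inside the squared loop. [folklore] -/
theorem sq_mem_inside_sq (h0 : (0 : ℂ) ∈ outside X) {w : ℂ} (hw : w ∈ inside X) :
    w ^ 2 ∈ inside (fun t => X t ^ 2) := by
  have hwo := neg_mem_outside_of_mem_inside h hanti h0 hw
  have hz : w ^ 2 ∉ range (fun t => X t ^ 2) := sq_not_mem_range_sq hw.1 hwo.1
  rw [(sq h hanti).mem_inside_iff_wind_ne_zero hz, wind_sq_sub_sq h hw.1 hwo.1,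
    (h.mem_outside_iff_wind_eq_zero hwo.1).1 hwo, add_zero]
  exact (h.mem_inside_iff_wind_ne_zero hw.1).1 hw

/-- `0` is outside the squared loop. [folklore] -/
theorem zero_mem_outside_sq (h0 : (0 : ℂ) ∈ outside X) : (0 : ℂ) ∈ outside (fun t => X t ^ 2) := by
  have hr : (0 : ℂ) ∉ range (fun t => X t ^ 2) := by
    rintro ⟨t, ht⟩
    exact ne_zero_of_antipode hanti t ((pow_eq_zero_iff two_ne_zero).1 ht)
  rw [(sq h hanti).mem_outside_iff_wind_eq_zero hr]
  have e : (fun t => X t ^ 2 - 0) = fun t => (X t - 0) * (X t - 0) := by funext t; ring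
  rw [e, wind_mul (h.isNonvanishingLoop_sub h0.1) (h.isNonvanishingLoop_sub h0.1),
    (h.mem_outside_iff_wind_eq_zero h0.1).1 h0, add_zero]

/-- Inside points of the squared loop have a square root inside. [folklore] -/
theorem exists_sq_eq_of_mem_inside_sq (h0 : (0 : ℂ) ∈ outside X) {z : ℂ}
    (hz : z ∈ inside (fun t => X t ^ 2)) : ∃ w ∈ inside X, w ^ 2 = z := by
  have hz0 : z ≠ 0 := by
    rintro rfl
    exact Set.disjoint_left.1 disjoint_inside_outside hz (zero_mem_outside_sq h hanti h0)
  set w₀ : ℂ := exp (log z / 2) with hw₀def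
  have hw₀ : w₀ ^ 2 = z := by rw [hw₀def, pow_two, ← exp_add, add_halves, exp_log hz0]
  have hw₀r : w₀ ∉ range X := fun ⟨t, ht⟩ => hz.1 ⟨t, by simp only [ht, hw₀]⟩
  have hw₀r' : -w₀ ∉ range X := fun ⟨t, ht⟩ => hz.1 ⟨t, by simp only [ht, neg_sq, hw₀]⟩
  have hw := ((sq h hanti).mem_inside_iff_wind_ne_zero hz.1).1 hz
  rw [← hw₀, wind_sq_sub_sq h hw₀r hw₀r'] at hw
  by_cases h1 : wind (fun t => X t - w₀) = 0
  · rw [h1, zero_add] at hw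
    exact ⟨-w₀, (h.mem_inside_iff_wind_ne_zero hw₀r').2 hw, by rw [neg_sq, hw₀]⟩
  · exact ⟨w₀, (h.mem_inside_iff_wind_ne_zero hw₀r).2 h1, hw₀⟩

/-- **Squaring lemma**: for an antipode-free Jordan loop with `0` outside, squaring maps the
inside onto the inside of the squared loop. [folklore] -/
theorem sq_image_inside (h0 : (0 : ℂ) ∈ outside X) :
    (fun w => w ^ 2) '' inside X = inside (fun t => X t ^ 2) := by
  ext z
  constructor
  · rintro ⟨w, hw, rfl⟩
    exact sq_mem_inside_sq h hanti h0 hw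
  · intro hz
    obtain ⟨w, hw, rfl⟩ := exists_sq_eq_of_mem_inside_sq h hanti h0 hz
    exact ⟨w, hw, rfl⟩

/-- **Lifting paths through squaring.** A path inside the squared loop is the square of a path
inside the loop (a continuous square root along the path lands in `inside X ∪ -inside X`, two
disjoint open sets). [folklore] -/
theorem exists_lift_sq (h0 : (0 : ℂ) ∈ outside X) {lam : ℝ → ℂ} (hlam : ContinuousOn lam (Icc 0 1))
    (hmem : ∀ t ∈ Icc (0 : ℝ) 1, lam t ∈ inside (fun t => X t ^ 2)) :
    ∃ lt : ℝ → ℂ, ContinuousOn lt (Icc 0 1) ∧ (∀ t ∈ Icc (0 : ℝ) 1, lt t ∈ inside X) ∧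
      ∀ t ∈ Icc (0 : ℝ) 1, lt t ^ 2 = lam t := by
  have hlam0 : ∀ t ∈ Icc (0 : ℝ) 1, lam t ≠ 0 := fun t ht h0' =>
    Set.disjoint_left.1 disjoint_inside_outside (h0' ▸ hmem t ht) (zero_mem_outside_sq h hanti h0)
  obtain ⟨l, hl, hle⟩ := hasLogOn_Icc hlam hlam0
  set r : ℝ → ℂ := fun t => exp (l t / 2) with hr
  have hrc : ContinuousOn r (Icc 0 1) := (hl.div_const 2).cexp
  have hr2 : ∀ t ∈ Icc (0 : ℝ) 1, r t ^ 2 = lam t := fun t ht => by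
    rw [hr]
    dsimp only
    rw [pow_two, ← exp_add, add_halves, hle t ht]
  have hrU : r '' Icc 0 1 ⊆ inside X ∪ (fun w => -w) ⁻¹' inside X := by
    rintro _ ⟨t, ht, rfl⟩
    obtain ⟨w, hw, hw2⟩ := exists_sq_eq_of_mem_inside_sq h hanti h0 (hmem t ht)
    rw [← hr2 t ht] at hw2
    rcases sq_eq_sq_iff_eq_or_eq_neg.1 hw2 with h1 | h1
    · exact Or.inl (h1 ▸ hw)
    · refine Or.inr ?_
      show -r t ∈ inside X
      rw [show -r t = w by rw [h1]]
      exact hw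
  have hopen2 : IsOpen ((fun w : ℂ => -w) ⁻¹' inside X) := h.isOpen_inside.preimage continuous_neg
  have hdisj : Disjoint (inside X) ((fun w : ℂ => -w) ⁻¹' inside X) :=
    Set.disjoint_left.2 fun w hw hw' => neg_not_mem_inside h hanti h0 hw hw'
  have hpre : IsPreconnected (r '' Icc 0 1) := isPreconnected_Icc.image r hrc
  rcases hpre.subset_or_subset h.isOpen_inside hopen2 hdisj hrU with hV | hV
  · exact ⟨r, hrc, fun t ht => hV ⟨t, ht, rfl⟩, hr2⟩
  · exact ⟨fun t => -r t, hrc.neg, fun t ht => hV ⟨t, ht, rfl⟩, fun t ht => by rw [neg_sq, hr2 t ht]⟩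

end Squaring

end IsJordanLoop

/-! ### Periodisation `W ∘ Int.fract` of a loop read on `[0, 1]` -/

/-- Fractional parts lie in `[0, 1]`. [folklore] -/
theorem fract_mem_Icc (t : ℝ) : Int.fract t ∈ Icc (0 : ℝ) 1 :=
  ⟨Int.fract_nonneg t, (Int.fract_lt_one t).le⟩

/-- Winding numbers are read on `[0, 1]`. [folklore] -/
theorem wind_comp_fract_sub {W : ℝ → ℂ} (h01 : W 0 = W 1) (a : ℂ) :
    wind (fun t => (W ∘ Int.fract) t - a) = wind (fun t => W t - a) :=
  wind_congr fun t ht => by simp only [comp_fract_apply_of_mem_Icc h01 ht]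

/-- A `1`-periodic function is determined by its values at fractional parts (a private copy
of `Function.Periodic.map_fract` of `RandomPlanarGeometry/ArcHullDomains.lean`, which is not in
the import cone of this file). [folklore] -/
private theorem periodic_map_fract {δ : ℝ → ℂ} (hδ : Function.Periodic δ 1) (t : ℝ) :
    δ (Int.fract t) = δ t := by
  rw [Int.fract, show t - (⌊t⌋ : ℝ) = t - (⌊t⌋ : ℤ) * (1 : ℝ) by ring]
  exact hδ.sub_int_mul_eq ⌊t⌋

/-- **Square roots of Jordan loops.** If `V` is continuous and nonvanishing on `[0, 1]` with
`V 0 = V 1` and `V² = δ` on `[0, 1]` for a Jordan loop `δ`, then the periodisation of `V` is an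
antipode-free Jordan loop squaring to `δ`. [folklore] -/
theorem isJordanLoop_comp_fract_of_sq {V δ : ℝ → ℂ} (hV : ContinuousOn V (Icc 0 1))
    (hV01 : V 0 = V 1) (hV0 : ∀ s, V s ≠ 0) (hδ : IsJordanLoop δ)
    (hsq : ∀ s ∈ Icc (0 : ℝ) 1, V s ^ 2 = δ s) :
    IsJordanLoop (V ∘ Int.fract) ∧ (∀ s t, (V ∘ Int.fract) s ≠ -(V ∘ Int.fract) t) ∧
      ∀ t, (V ∘ Int.fract) t ^ 2 = δ t := by
  have hsqall : ∀ t, (V ∘ Int.fract) t ^ 2 = δ t := fun t => by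
    show V (Int.fract t) ^ 2 = δ t
    rw [hsq _ (fract_mem_Icc t), periodic_map_fract hδ.periodic]
  have hinj : ∀ s t, δ s = δ t → (V ∘ Int.fract) s = (V ∘ Int.fract) t := fun s t hst => by
    rw [← periodic_map_fract hδ.periodic s, ← periodic_map_fract hδ.periodic t] at hst
    have := hδ.injOn ⟨Int.fract_nonneg s, Int.fract_lt_one s⟩ ⟨Int.fract_nonneg t, Int.fract_lt_one t⟩ hst
    show V (Int.fract s) = V (Int.fract t)
    rw [this]
  refine ⟨⟨hV.comp_fract'' hV01, periodic_comp_fract, fun s hs t ht hst => ?_⟩, fun s t hst => ?_,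
    hsqall⟩
  · have h2 : δ s = δ t := by rw [← hsqall s, ← hsqall t, hst]
    exact hδ.injOn hs ht h2
  · have h2 : δ s = δ t := by rw [← hsqall s, ← hsqall t, hst, neg_sq]
    have h3 := hinj s t h2
    rw [h3] at hst
    exact hV0 _ (show (V ∘ Int.fract) t = 0 from by
      have : (2 : ℂ) * (V ∘ Int.fract) t = 0 := by rw [two_mul]; nth_rewrite 1 [hst]; ring
      exact (mul_eq_zero.1 this).resolve_left two_ne_zero)

/-! ### The theorem -/

/-- `2πi ≠ 0`. [folklore] -/
private theorem two_pi_I_ne_zero' : (2 * π * I : ℂ) ≠ 0 := by simp [Real.pi_ne_zero, I_ne_zero]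

/-- **Crossing parity of a cut by paths inside a swept Jordan curve.** Let `γ, γ'` be Jordan
loops and `H` a homotopy of loops in `ℂ \ {0}` from `γ|[0,1]` to `γ'|[0,1]` (jointly continuous
on the square). Let `A ∋ 0` be preconnected, unbounded and disjoint from `γ`. Let `λ` be a path
in the inside of `γ'` whose endpoints are never hit by the homotopy. Then for every path `ν`
from `λ 1` back to `λ 0` missing `A`, the loop `λ ∗ ν` has **even** winding number about `0`.
[folklore] (the branched-double-cover argument behind Garban–Pete–Schramm, JAMS 26 (2013),
§2.3, in a deterministic discrete form; proof by continuous square roots, see the module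
docstring). -/
theorem even_wind_concatPath_of_loopHomotopy {γ γ' : ℝ → ℂ} (hγ : IsJordanLoop γ)
    (hγ' : IsJordanLoop γ') {H : ℝ → ℝ → ℂ} (hH : ContinuousOn (uncurry H) (Icc 0 1 ×ˢ Icc 0 1))
    (hH0 : ∀ s ∈ Icc (0 : ℝ) 1, H 0 s = γ s) (hH1 : ∀ s ∈ Icc (0 : ℝ) 1, H 1 s = γ' s)
    (hloop : ∀ τ ∈ Icc (0 : ℝ) 1, H τ 0 = H τ 1)
    (hne : ∀ τ ∈ Icc (0 : ℝ) 1, ∀ s ∈ Icc (0 : ℝ) 1, H τ s ≠ 0)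
    {A : Set ℂ} (hA : IsPreconnected A) (h0A : (0 : ℂ) ∈ A) (hAb : ¬ IsBounded A)
    (hAγ : A ⊆ (range γ)ᶜ)
    {lam : ℝ → ℂ} (hlam : ContinuousOn lam (Icc 0 1))
    (hlamin : ∀ s ∈ Icc (0 : ℝ) 1, lam s ∈ IsJordanLoop.inside γ')
    (hx : ∀ τ ∈ Icc (0 : ℝ) 1, ∀ s ∈ Icc (0 : ℝ) 1, H τ s ≠ lam 0)
    (hy : ∀ τ ∈ Icc (0 : ℝ) 1, ∀ s ∈ Icc (0 : ℝ) 1, H τ s ≠ lam 1)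
    {nu : ℝ → ℂ} (hnu : ContinuousOn nu (Icc 0 1)) (hnu0 : nu 0 = lam 1) (hnu1 : nu 1 = lam 0)
    (hnuA : ∀ s ∈ Icc (0 : ℝ) 1, nu s ∉ A) :
    Even (wind (concatPath lam nu)) := by
  have hI0 : (0 : ℝ) ∈ Icc (0 : ℝ) 1 := zero_mem_Icc01
  have hI1 : (1 : ℝ) ∈ Icc (0 : ℝ) 1 := one_mem_Icc01
  /- Step 0: `0` is outside `γ`. -/
  have h0γ : (0 : ℂ) ∈ IsJordanLoop.outside γ :=
    IsJordanLoop.subset_outside_of_isPreconnected hA hAγ hAb h0A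
  have hw0 : wind (fun s => γ s - 0) = 0 := (hγ.mem_outside_iff_wind_eq_zero h0γ.1).1 h0γ
  /- Step 1: a joint logarithm of `H` on the square (parametrised by `ℂ ⊇ [0,1]²`). -/
  set F : ℂ → ℂ := fun z => H (projIcc 0 1 zero_le_one z.re) (projIcc 0 1 zero_le_one z.im) with hF
  have hFc : Continuous F := by
    have h1 : Continuous fun z : ℂ =>
        ((projIcc 0 1 zero_le_one z.re : ℝ), (projIcc 0 1 zero_le_one z.im : ℝ)) := by fun_prop
    exact hH.comp_continuous h1 fun z =>
      ⟨(projIcc 0 1 zero_le_one z.re).2, (projIcc 0 1 zero_le_one z.im).2⟩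
  have hF0 : ∀ z, F z ≠ 0 := fun z =>
    hne _ (projIcc 0 1 zero_le_one z.re).2 _ (projIcc 0 1 zero_le_one z.im).2
  obtain ⟨Lc, hLc, hLe⟩ := hasLogOn_univ isSimplyConnected_univ_complex hFc hF0
  have hLcc : Continuous Lc := continuousOn_univ.1 hLc
  set L : ℝ → ℝ → ℂ := fun τ s => Lc (τ + s * I) with hL
  have hLcont : Continuous (uncurry L) := by
    have : Continuous fun p : ℝ × ℝ => ((p.1 : ℂ) + p.2 * I) := by fun_prop
    exact hLcc.comp this
  have hLexp : ∀ τ ∈ Icc (0 : ℝ) 1, ∀ s ∈ Icc (0 : ℝ) 1, exp (L τ s) = H τ s := by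
    intro τ hτ s hs
    show exp (Lc (τ + s * I)) = H τ s
    rw [hLe _ (mem_univ _)]
    show H (projIcc 0 1 zero_le_one ((τ : ℂ) + s * I).re)
      (projIcc 0 1 zero_le_one ((τ : ℂ) + s * I).im) = H τ s
    have hre : ((τ : ℂ) + s * I).re = τ := by simp
    have him : ((τ : ℂ) + s * I).im = s := by simp
    rw [hre, him, projIcc_of_mem _ hτ, projIcc_of_mem _ hs]
  /- Step 2: `L τ ·` closes up (`L τ 1 = L τ 0`): an integer-valued continuous function of
  `τ`, vanishing at `τ = 0` because `wind γ = 0`. -/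
  have hclose : ∀ τ ∈ Icc (0 : ℝ) 1, L τ 1 - L τ 0 = 0 := by
    set T : Set ℂ := (AddSubgroup.zmultiples (2 * Real.pi * I) : Set ℂ) with hT
    have hTd : IsDiscrete T :=
      isDiscrete_iff_discreteTopology.2 (NormedSpace.discreteTopology_zmultiples _)
    have hmaps : MapsTo (fun τ => L τ 1 - L τ 0) (Icc 0 1) T := fun τ hτ => by
      have h1 : exp (L τ 1 - L τ 0) = 1 := by
        rw [exp_sub, hLexp τ hτ 1 hI1, hLexp τ hτ 0 hI0, hloop τ hτ, div_self (hne τ hτ 1 hI1)]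
      obtain ⟨n, hn⟩ := exp_eq_one_iff.1 h1
      rw [hT, SetLike.mem_coe, AddSubgroup.mem_zmultiples_iff]
      exact ⟨n, by simp only [hn, zsmul_eq_mul]⟩
    have hcont : ContinuousOn (fun τ => L τ 1 - L τ 0) (Icc 0 1) := by
      have h1 : Continuous fun τ : ℝ => L τ 1 :=
        hLcont.comp (by fun_prop : Continuous fun τ : ℝ => (τ, (1 : ℝ)))
      have h2 : Continuous fun τ : ℝ => L τ 0 :=
        hLcont.comp (by fun_prop : Continuous fun τ : ℝ => (τ, (0 : ℝ)))
      exact (h1.sub h2).continuousOn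
    have h00 : L 0 1 - L 0 0 = 0 := by
      have hl0 : ContinuousOn (L 0) (Icc 0 1) :=
        (hLcont.comp (by fun_prop : Continuous fun s : ℝ => ((0 : ℝ), s))).continuousOn
      have := wind_spec (f := fun s => γ s - 0) (l := L 0) hl0
        (fun s hs => by rw [hLexp 0 hI0 s hs, hH0 s hs, sub_zero]) (by rw [hγ.eq_zero_one])
      rw [hw0, Int.cast_zero, zero_mul] at this
      exact this
    intro τ hτ
    have := isPreconnected_Icc.constant_of_mapsTo hTd hcont hmaps hτ hI0
    rw [this, h00]
  /- Step 3: square roots `W τ = exp(L τ / 2)` of the loops `H τ`; `X₀, X₁` the periodisations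
  at `τ = 0, 1` (antipode-free Jordan loops with `0` outside). -/
  set W : ℝ → ℝ → ℂ := fun τ s => exp (L τ s / 2) with hW
  have hWcont : Continuous (uncurry W) := by
    show Continuous fun p : ℝ × ℝ => exp (L p.1 p.2 / 2)
    exact (hLcont.div_const 2).cexp
  have hW2 : ∀ τ ∈ Icc (0 : ℝ) 1, ∀ s ∈ Icc (0 : ℝ) 1, W τ s ^ 2 = H τ s := fun τ hτ s hs => by
    show exp (L τ s / 2) ^ 2 = H τ s
    rw [pow_two, ← exp_add, add_halves, hLexp τ hτ s hs]
  have hW01 : ∀ τ ∈ Icc (0 : ℝ) 1, W τ 0 = W τ 1 := fun τ hτ => by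
    show exp (L τ 0 / 2) = exp (L τ 1 / 2)
    rw [sub_eq_zero.1 (hclose τ hτ)]
  have hWne : ∀ τ s, W τ s ≠ 0 := fun τ s => exp_ne_zero _
  have hcW : ∀ i : ℝ, ContinuousOn (W i) (Icc 0 1) := fun i =>
    (hWcont.comp (by fun_prop : Continuous fun s : ℝ => (i, s))).continuousOn
  obtain ⟨hX0J, hX0a, hX0sq⟩ := isJordanLoop_comp_fract_of_sq (hcW 0) (hW01 0 hI0) (hWne 0) hγ
    fun s hs => by rw [hW2 0 hI0 s hs, hH0 s hs]
  obtain ⟨hX1J, hX1a, hX1sq⟩ := isJordanLoop_comp_fract_of_sq (hcW 1) (hW01 1 hI1) (hWne 1) hγ'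
    fun s hs => by rw [hW2 1 hI1 s hs, hH1 s hs]
  set X0 : ℝ → ℂ := (W 0 ∘ Int.fract) with hX0
  set X1 : ℝ → ℂ := (W 1 ∘ Int.fract) with hX1
  have hX0sq' : (fun t => X0 t ^ 2) = γ := funext hX0sq
  have hX1sq' : (fun t => X1 t ^ 2) = γ' := funext hX1sq
  -- `0` is outside `X₀`, `X₁`
  have hout : ∀ {i : ℝ}, i ∈ Icc (0 : ℝ) 1 → IsJordanLoop ((W i ∘ Int.fract)) →
      (∀ s t, (W i ∘ Int.fract) s ≠ -(W i ∘ Int.fract) t) → (0 : ℂ) ∈ IsJordanLoop.outside ((W i ∘ Int.fract)) := by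
    intro i hi hJ ha
    have hr : (0 : ℂ) ∉ range ((W i ∘ Int.fract)) := IsJordanLoop.zero_not_mem_range ha
    rw [hJ.mem_outside_iff_wind_eq_zero hr, wind_comp_fract_sub (hW01 i hi)]
    have hl : ContinuousOn (fun s => L i s / 2) (Icc 0 1) :=
      ((hLcont.comp (by fun_prop : Continuous fun s : ℝ => (i, s))).div_const 2).continuousOn
    have hws := wind_spec (f := fun s => W i s - 0) (l := fun s => L i s / 2) hl
      (fun s _ => by rw [sub_zero]) (by rw [hW01 i hi])
    have : (wind (fun s => W i s - 0) : ℂ) * (2 * π * I) = 0 := by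
      rw [← hws, ← sub_div, hclose i hi, zero_div]
    exact_mod_cast (mul_eq_zero.1 this).resolve_right two_pi_I_ne_zero'
  have h0X0 : (0 : ℂ) ∈ IsJordanLoop.outside X0 := hout hI0 hX0J hX0a
  have h0X1 : (0 : ℂ) ∈ IsJordanLoop.outside X1 := hout hI1 hX1J hX1a
  have h0γ' : (0 : ℂ) ∈ IsJordanLoop.outside γ' := by
    rw [← hX1sq']; exact hX1J.zero_mem_outside_sq hX1a h0X1
  /- Step 4: lift `lam` to a path `lt` inside `X₁` with `lt² = lam`. -/
  have hlamin' : ∀ s ∈ Icc (0 : ℝ) 1, lam s ∈ IsJordanLoop.inside (fun t => X1 t ^ 2) := by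
    rw [hX1sq']; exact hlamin
  obtain ⟨lt, hltc, hltin, hlt2⟩ := hX1J.exists_lift_sq hX1a h0X1 hlam hlamin'
  /- Step 5: both endpoints of `lt` are inside `X₀` (the homotopy `W τ - lt e` of loops). -/
  have hends : ∀ {e : ℝ}, e ∈ Icc (0 : ℝ) 1 →
      (∀ τ ∈ Icc (0 : ℝ) 1, ∀ s ∈ Icc (0 : ℝ) 1, H τ s ≠ lam e) → lt e ∈ IsJordanLoop.inside X0 := by
    intro e he hHe
    set a := lt e with ha
    have hc : ContinuousOn (uncurry fun τ s => W τ s - a) (Icc 0 1 ×ˢ Icc 0 1) :=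
      (hWcont.sub continuous_const).continuousOn
    have hl : ∀ τ ∈ Icc (0 : ℝ) 1, (fun τ s => W τ s - a) τ 0 = (fun τ s => W τ s - a) τ 1 :=
      fun τ hτ => by simp only [hW01 τ hτ]
    have hn : ∀ τ ∈ Icc (0 : ℝ) 1, ∀ s ∈ Icc (0 : ℝ) 1, (fun τ s => W τ s - a) τ s ≠ 0 := by
      intro τ hτ s hs h0
      have h1 : W τ s = a := sub_eq_zero.1 h0
      refine hHe τ hτ s hs ?_
      rw [← hW2 τ hτ s hs, h1, ha, hlt2 e he]
    have hhom := wind_eq_of_homotopy hc hl hn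
    -- `wind (X₁ - a) ≠ 0`
    have hin1 : a ∈ IsJordanLoop.inside X1 := hltin e he
    have hne1 := (hX1J.mem_inside_iff_wind_ne_zero hin1.1).1 hin1
    rw [hX1, wind_comp_fract_sub (hW01 1 hI1)] at hne1
    change wind (fun s => W 0 s - a) = wind (fun s => W 1 s - a) at hhom
    rw [← hhom] at hne1
    have har : a ∉ range X0 := by
      rintro ⟨t, ht⟩
      refine hHe 0 hI0 _ (fract_mem_Icc t) ?_
      rw [hH0 _ (fract_mem_Icc t), periodic_map_fract hγ.periodic, ← hX0sq t, ht, ha, hlt2 e he]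
    rw [hX0J.mem_inside_iff_wind_ne_zero har, hX0, wind_comp_fract_sub (hW01 0 hI0)]
    exact hne1
  have hxin : lt 0 ∈ IsJordanLoop.inside X0 := hends hI0 hx
  have hyin : lt 1 ∈ IsJordanLoop.inside X0 := hends hI1 hy
  /- Step 6: join the lifted endpoints inside `X₀`, square: an inside return path `nu0` with
  `λ ∗ ν₀ = (lt ∗ nt)²`, of even winding number. -/
  obtain ⟨p, hp⟩ : ∃ p : Path (lt 1) (lt 0), ∀ t, p t ∈ IsJordanLoop.inside X0 :=
    ⟨(hX0J.joinedIn_inside hyin hxin).somePath, (hX0J.joinedIn_inside hyin hxin).somePath_mem⟩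
  set nt : ℝ → ℂ := fun t => p.extend t with hnt
  have hntin : ∀ t, nt t ∈ IsJordanLoop.inside X0 := fun t => by
    obtain ⟨u, hu⟩ : nt t ∈ range p := by rw [← Path.extend_range p]; exact mem_range_self t
    rw [← hu]
    exact hp u
  have hntc : Continuous nt := p.continuous_extend
  set nu0 : ℝ → ℂ := fun t => nt t ^ 2 with hnu0def
  have hnu0in : ∀ t, nu0 t ∈ IsJordanLoop.inside γ := fun t => by
    rw [← hX0sq']
    exact hX0J.sq_mem_inside_sq hX0a h0X0 (hntin t)
  have hltP : IsNVPath lt := ⟨hltc, fun t ht h0 =>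
    Set.disjoint_left.1 IsJordanLoop.disjoint_inside_outside (h0 ▸ hltin t ht) h0X1⟩
  have hntP : IsNVPath nt := ⟨hntc.continuousOn, fun t _ h0 =>
    Set.disjoint_left.1 IsJordanLoop.disjoint_inside_outside (h0 ▸ hntin t) h0X0⟩
  have hmatch : lt 1 = nt 0 := (p.extend_zero).symm
  have hmatch' : nt 1 = lt 0 := p.extend_one
  have hloopP : IsNonvanishingLoop (concatPath lt nt) :=
    { (hltP.concatPath hntP hmatch) with
      eq_endpoints := by rw [concatPath_zero, concatPath_one, hmatch'] }
  have heq : EqOn (concatPath lam nu0) (fun t => concatPath lt nt t ^ (2 : ℤ)) (Icc 0 1) := by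
    intro t ht
    show concatPath lam nu0 t = concatPath lt nt t ^ (2 : ℤ)
    rw [zpow_two, ← pow_two]
    by_cases h : t ≤ 1 / 2
    · rw [concatPath_of_le_half h, concatPath_of_le_half h, hlt2 _ ⟨by linarith [ht.1], by linarith⟩]
    · rw [concatPath_of_half_lt (not_le.1 h), concatPath_of_half_lt (not_le.1 h)]
  have heven0 : Even (wind (concatPath lam nu0)) := by
    rw [wind_congr heq, wind_zpow hloopP 2]
    exact even_two_mul _
  /- Step 7: any other return path `nu` missing `A` gives the same winding number: the
  difference is the winding number of the loop `ν₀⁻¹ ∗ ν`, which misses `A`. -/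
  have hlamP : IsNVPath lam := ⟨hlam, fun t ht h0 =>
    Set.disjoint_left.1 IsJordanLoop.disjoint_inside_outside (h0 ▸ hlamin t ht) h0γ'⟩
  have hnuP : IsNVPath nu := ⟨hnu, fun t ht h0 => hnuA t ht (h0 ▸ h0A)⟩
  have hnu0P : IsNVPath nu0 := ⟨(hntc.pow 2).continuousOn, fun t _ h0 =>
    Set.disjoint_left.1 IsJordanLoop.disjoint_inside_outside (h0 ▸ hnu0in t) h0γ⟩
  have hmaps : MapsTo (fun t : ℝ => 1 - t) (Icc 0 1) (Icc 0 1) := fun t ht =>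
    ⟨by linarith [ht.2], by linarith [ht.1]⟩
  have hrevP : IsNVPath fun t => nu0 (1 - t) :=
    ⟨hnu0P.continuousOn.comp (by fun_prop) hmaps, fun t ht => hnu0P.ne_zero _ (hmaps ht)⟩
  have hnu00 : nu0 0 = lam 1 := by
    show nt 0 ^ 2 = lam 1
    rw [← hmatch, hlt2 1 hI1]
  have hnu01 : nu0 1 = lam 0 := by
    show nt 1 ^ 2 = lam 0
    rw [hmatch', hlt2 0 hI0]
  have e1 := wind_concatPath_mul hlamP hnuP hnu0.symm hnu1
  have e2 := wind_concatPath_mul hlamP hnu0P hnu00.symm hnu01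
  have e3 := wind_concatPath_mul hrevP hnuP (by show nu0 (1 - 1) = nu 0; norm_num [hnu00, hnu0])
    (by show nu 1 = nu0 (1 - 0); norm_num [hnu01, hnu1])
  have hAout : A ⊆ IsJordanLoop.outside γ := IsJordanLoop.subset_outside_of_isPreconnected hA hAγ hAb
  have hz : wind (concatPath (fun t => nu0 (1 - t)) nu) = 0 := by
    refine wind_eq_zero_of_forall_not_mem
      (continuousOn_concatPath hrevP.continuousOn hnu (by show nu0 (1 - 1) = nu 0; norm_num [hnu00, hnu0]))
      (by rw [concatPath_zero, concatPath_one]; show nu0 (1 - 0) = nu 1; norm_num [hnu01, hnu1])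
      hA h0A hAb fun t ht => ?_
    refine mapsTo_concatPath (S := Aᶜ) (fun u _ hu => ?_) (fun u hu => hnuA u hu) ht
    exact Set.disjoint_left.1 IsJordanLoop.disjoint_inside_outside (hnu0in (1 - u)) (hAout hu)
  have key : ((wind (concatPath lam nu) : ℂ) - wind (concatPath lam nu0)) * (2 * π * I) =
      (wind (concatPath (fun t => nu0 (1 - t)) nu) : ℂ) * (2 * π * I) := by
    rw [sub_mul, e1, e2, e3, logInc_reverse hnu0P.hasLogOn]
    ring
  rw [hz, Int.cast_zero, zero_mul, mul_eq_zero, sub_eq_zero] at key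
  have : wind (concatPath lam nu) = wind (concatPath lam nu0) := by
    exact_mod_cast key.resolve_right two_pi_I_ne_zero'
  rw [this]
  exact heven0

/-! ### Finite branch points: the Möbius normalisation

For a cut `cut` from `P₀` to `P₁` (both finite) one conjugates by the Möbius map
`g z = (z - P₀)/(z - P₁)` (`crossRatioFn P₀ P₁` of `ArgumentIncrement.lean`), which sends `P₀ ↦ 0`, `P₁ ↦ ∞`, is injective off `P₁`, and satisfies
`g x - g a = (P₀ - P₁)/(a - P₁) · (x - a)/(x - P₁)`, so that winding numbers of `g ∘ Γ` about
`g a` are differences of winding numbers of `Γ` about `a` and about `P₁`. -/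

section Mobius

variable {P₀ P₁ : ℂ}

/-- `g x - g a = (P₀ - P₁)/(a - P₁) · (x - a)/(x - P₁)`. [folklore] -/
theorem crossRatioFn_sub_crossRatioFn {x a : ℂ} (hx : x ≠ P₁) (ha : a ≠ P₁) :
    crossRatioFn P₀ P₁ x - crossRatioFn P₀ P₁ a = (P₀ - P₁) / (a - P₁) * ((x - a) / (x - P₁)) := by
  have hx' : x - P₁ ≠ 0 := sub_ne_zero.2 hx
  have ha' : a - P₁ ≠ 0 := sub_ne_zero.2 ha
  simp only [crossRatioFn]
  field_simp
  ring

/-- The Möbius map is injective off `P₁` (for `P₀ ≠ P₁`). [folklore] -/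
theorem crossRatioFn_injective (h01 : P₀ ≠ P₁) {x y : ℂ} (hx : x ≠ P₁) (hy : y ≠ P₁)
    (h : crossRatioFn P₀ P₁ x = crossRatioFn P₀ P₁ y) : x = y := by
  have key := crossRatioFn_sub_crossRatioFn (P₀ := P₀) hx hy
  rw [h, sub_self, eq_comm, mul_eq_zero] at key
  rcases key with h1 | h1
  · rw [div_eq_zero_iff, sub_eq_zero, sub_eq_zero] at h1
    rcases h1 with h1 | h1
    · exact (h01 h1).elim
    · exact (hy h1).elim
  · rw [div_eq_zero_iff, sub_eq_zero, sub_eq_zero] at h1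
    rcases h1 with h1 | h1
    · exact h1
    · exact (hx h1).elim

/-- The Möbius map is continuous off `P₁`. [folklore] -/
theorem continuousOn_crossRatioFn : ContinuousOn (crossRatioFn P₀ P₁) {z | z ≠ P₁} := by
  show ContinuousOn (fun z => (z - P₀) / (z - P₁)) {z | z ≠ P₁}
  exact ContinuousOn.div (by fun_prop) (by fun_prop) fun _ hz => sub_ne_zero.2 hz

/-- `g z = 0 ↔ z = P₀` off `P₁`. [folklore] -/
theorem crossRatioFn_eq_zero_iff {z : ℂ} (hz : z ≠ P₁) : crossRatioFn P₀ P₁ z = 0 ↔ z = P₀ := by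
  rw [crossRatioFn, div_eq_zero_iff, sub_eq_zero, sub_eq_zero, or_iff_left hz]

/-- **Winding numbers through the Möbius map**: for a loop `f` off `P₁` and off `a ≠ P₁`,
`wind (g ∘ f - g a) = wind (f - a) - wind (f - P₁)`. [folklore] -/
theorem wind_crossRatioFn_sub (h01 : P₀ ≠ P₁) {f : ℝ → ℂ} (hf : ContinuousOn f (Icc 0 1))
    (hf01 : f 0 = f 1) (hfP₁ : ∀ t ∈ Icc (0 : ℝ) 1, f t ≠ P₁) {a : ℂ} (ha : a ≠ P₁)
    (hfa : ∀ t ∈ Icc (0 : ℝ) 1, f t ≠ a) :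
    wind (fun t => crossRatioFn P₀ P₁ (f t) - crossRatioFn P₀ P₁ a) =
      wind (fun t => f t - a) - wind (fun t => f t - P₁) := by
  have hc : (P₀ - P₁) / (a - P₁) ≠ 0 := div_ne_zero (sub_ne_zero.2 h01) (sub_ne_zero.2 ha)
  have hla : IsNonvanishingLoop fun t => f t - a :=
    ⟨hf.sub continuousOn_const, fun t ht => sub_ne_zero.2 (hfa t ht), by rw [hf01]⟩
  have hl1 : IsNonvanishingLoop fun t => f t - P₁ :=
    ⟨hf.sub continuousOn_const, fun t ht => sub_ne_zero.2 (hfP₁ t ht), by rw [hf01]⟩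
  rw [wind_congr (g := fun t => (P₀ - P₁) / (a - P₁) * ((f t - a) / (f t - P₁)))
    fun t ht => crossRatioFn_sub_crossRatioFn (hfP₁ t ht) ha,
    wind_mul (IsNonvanishingLoop.const hc) (hla.div hl1), wind_const, wind_div hla hl1, zero_add]

/-- The image under `g` of the half-open cut `cut|[0,1)` (ending at `P₁`, not meeting `P₁`
before) is unbounded. [folklore] -/
theorem not_isBounded_image_crossRatioFn_cut (h01 : P₀ ≠ P₁) {cut : ℝ → ℂ} (hcut : ContinuousOn cut (Icc 0 1))
    (hcut1 : cut 1 = P₁) (hcutP₁ : ∀ t ∈ Ico (0 : ℝ) 1, cut t ≠ P₁) :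
    ¬ IsBounded ((fun t => crossRatioFn P₀ P₁ (cut t)) '' Ico 0 1) := by
  intro hb
  obtain ⟨R, hR⟩ := (isBounded_iff_subset_closedBall 0).1 hb
  set D : ℝ := ‖P₁ - P₀‖ with hD
  have hD0 : 0 < D := norm_pos_iff.2 (sub_ne_zero.2 h01.symm)
  set M : ℝ := max R 0 + 2 with hM
  have hM0 : 0 < M := by rw [hM]; linarith [le_max_right R 0]
  set ε : ℝ := D / (2 * M) with hε
  have hε0 : 0 < ε := by positivity
  have hεD : ε ≤ D / 2 := by
    rw [hε, div_le_div_iff₀ (by positivity) (by norm_num)]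
    nlinarith [le_max_right R 0]
  have hc1 : ContinuousWithinAt cut (Icc 0 1) 1 := hcut 1 one_mem_Icc01
  rw [Metric.continuousWithinAt_iff] at hc1
  obtain ⟨δ, hδ, hδε⟩ := hc1 ε hε0
  set t : ℝ := max 0 (1 - δ / 2) with ht
  have ht0 : 0 ≤ t := le_max_left _ _
  have ht1 : t < 1 := max_lt one_pos (by linarith)
  have htδ : dist t 1 < δ := by
    rw [dist_comm, Real.dist_eq, abs_of_nonneg (by linarith)]
    have : 1 - δ / 2 ≤ t := le_max_right _ _
    linarith
  have hcutt : ‖cut t - P₁‖ < ε := by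
    rw [← dist_eq_norm, ← hcut1]
    exact hδε ⟨ht0, ht1.le⟩ htδ
  have hP₀ : D / 2 ≤ ‖cut t - P₀‖ := by
    have : D ≤ ‖cut t - P₀‖ + ‖cut t - P₁‖ := by
      calc D = ‖(cut t - P₀) - (cut t - P₁)‖ := by rw [hD]; congr 1; ring
        _ ≤ ‖cut t - P₀‖ + ‖cut t - P₁‖ := norm_sub_le _ _
    linarith
  have hpos : 0 < ‖cut t - P₁‖ := norm_pos_iff.2 (sub_ne_zero.2 (hcutP₁ t ⟨ht0, ht1⟩))
  have hmem : crossRatioFn P₀ P₁ (cut t) ∈ (fun t => crossRatioFn P₀ P₁ (cut t)) '' Ico 0 1 :=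
    ⟨t, ⟨ht0, ht1⟩, rfl⟩
  have hle : ‖crossRatioFn P₀ P₁ (cut t)‖ ≤ R := by
    have := hR hmem
    rwa [mem_closedBall, dist_zero_right] at this
  rw [crossRatioFn, norm_div, div_le_iff₀ hpos] at hle
  -- `D/2 ≤ ‖cut t - P₀‖ ≤ R ‖cut t - P₁‖ < R ε ≤ max R 0 · ε`, while `M ε = D/2`
  have h1 : ‖cut t - P₀‖ ≤ max R 0 * ε :=
    hle.trans ((mul_le_mul_of_nonneg_right (le_max_left R 0) hpos.le).trans
      (mul_le_mul_of_nonneg_left hcutt.le (le_max_right R 0)))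
  have h2 : M * ε = D / 2 := by
    rw [hε]; field_simp
  nlinarith [le_max_right R 0]

/-- **Crossing parity with finite branch points.** Let `Γ, Γ'` be Jordan loops joined by a
homotopy of loops `H` missing `P₀ ≠ P₁`, `cut` a path from `P₀` to `P₁` missing `Γ` (and not
passing through `P₁` before its end), `λ` a path off `Γ'` on the *other side of `Γ'` than `P₀`*
(different winding numbers) whose endpoints are never hit by `H`, and `ν` a return path from
`λ 1` to `λ 0` missing `cut`. Then `wind (λ ∗ ν - P₀) - wind (λ ∗ ν - P₁)` is even, i.e. `λ ∗ ν`
crosses the cut `cut` an even number of times. [folklore] -/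
theorem even_wind_sub_wind_of_loopHomotopy (h01 : P₀ ≠ P₁) {Γ Γ' : ℝ → ℂ} (hΓ : IsJordanLoop Γ)
    (hΓ' : IsJordanLoop Γ') {H : ℝ → ℝ → ℂ} (hH : ContinuousOn (uncurry H) (Icc 0 1 ×ˢ Icc 0 1))
    (hH0 : ∀ s ∈ Icc (0 : ℝ) 1, H 0 s = Γ s) (hH1 : ∀ s ∈ Icc (0 : ℝ) 1, H 1 s = Γ' s)
    (hloop : ∀ τ ∈ Icc (0 : ℝ) 1, H τ 0 = H τ 1)
    (hHP₀ : ∀ τ ∈ Icc (0 : ℝ) 1, ∀ s ∈ Icc (0 : ℝ) 1, H τ s ≠ P₀)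
    (hHP₁ : ∀ τ ∈ Icc (0 : ℝ) 1, ∀ s ∈ Icc (0 : ℝ) 1, H τ s ≠ P₁)
    {cut : ℝ → ℂ} (hcut : ContinuousOn cut (Icc 0 1)) (hcut0 : cut 0 = P₀) (hcut1 : cut 1 = P₁)
    (hcutP₁ : ∀ t ∈ Ico (0 : ℝ) 1, cut t ≠ P₁) (hcutΓ : ∀ t ∈ Icc (0 : ℝ) 1, cut t ∉ range Γ)
    {lam : ℝ → ℂ} (hlam : ContinuousOn lam (Icc 0 1))
    (hlamΓ' : ∀ s ∈ Icc (0 : ℝ) 1, lam s ∉ range Γ')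
    (hside : ∀ s ∈ Icc (0 : ℝ) 1, wind (fun t => Γ' t - lam s) ≠ wind (fun t => Γ' t - P₀))
    (hx : ∀ τ ∈ Icc (0 : ℝ) 1, ∀ s ∈ Icc (0 : ℝ) 1, H τ s ≠ lam 0)
    (hy : ∀ τ ∈ Icc (0 : ℝ) 1, ∀ s ∈ Icc (0 : ℝ) 1, H τ s ≠ lam 1)
    {nu : ℝ → ℂ} (hnu : ContinuousOn nu (Icc 0 1)) (hnu0 : nu 0 = lam 1) (hnu1 : nu 1 = lam 0)
    (hnucut : ∀ s ∈ Icc (0 : ℝ) 1, ∀ t ∈ Icc (0 : ℝ) 1, nu s ≠ cut t) :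
    Even (wind (fun t => concatPath lam nu t - P₀) - wind (fun t => concatPath lam nu t - P₁)) := by
  set g : ℂ → ℂ := crossRatioFn P₀ P₁ with hg
  /- values of `Γ`, `Γ'` avoid `P₀`, `P₁` -/
  have havoid : ∀ {i : ℝ} {δ : ℝ → ℂ}, i ∈ Icc (0 : ℝ) 1 → IsJordanLoop δ →
      (∀ s ∈ Icc (0 : ℝ) 1, H i s = δ s) → ∀ t, δ t ≠ P₀ ∧ δ t ≠ P₁ := by
    intro i δ hi hδ hHi t
    obtain ⟨x, hx', hxt⟩ : δ t ∈ δ '' Icc 0 1 := by rw [← hδ.range_eq_image]; exact mem_range_self t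
    rw [← hxt, ← hHi x hx']
    exact ⟨hHP₀ i hi x hx', hHP₁ i hi x hx'⟩
  have hΓa := havoid zero_mem_Icc01 hΓ hH0
  have hΓ'a := havoid one_mem_Icc01 hΓ' hH1
  /- the transported loops are Jordan loops -/
  have hJ : ∀ {δ : ℝ → ℂ}, IsJordanLoop δ → (∀ t, δ t ≠ P₀ ∧ δ t ≠ P₁) → IsJordanLoop fun t => g (δ t) := by
    intro δ hδ ha
    refine ⟨continuousOn_crossRatioFn.comp_continuous hδ.continuous fun t => (ha t).2,
      fun t => by simp only [hδ.periodic t], fun s hs t ht hst => ?_⟩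
    exact hδ.injOn hs ht (crossRatioFn_injective h01 (ha s).2 (ha t).2 hst)
  have hγ : IsJordanLoop fun t => g (Γ t) := hJ hΓ hΓa
  have hγ' : IsJordanLoop fun t => g (Γ' t) := hJ hΓ' hΓ'a
  /- the transported homotopy -/
  set Hg : ℝ → ℝ → ℂ := fun τ s => g (H τ s) with hHg
  have hHgc : ContinuousOn (uncurry Hg) (Icc 0 1 ×ˢ Icc 0 1) :=
    continuousOn_crossRatioFn.comp hH fun p hp => hHP₁ p.1 hp.1 p.2 hp.2
  have hHg0 : ∀ s ∈ Icc (0 : ℝ) 1, Hg 0 s = g (Γ s) := fun s hs => by simp only [hHg, hH0 s hs]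
  have hHg1 : ∀ s ∈ Icc (0 : ℝ) 1, Hg 1 s = g (Γ' s) := fun s hs => by simp only [hHg, hH1 s hs]
  have hHgloop : ∀ τ ∈ Icc (0 : ℝ) 1, Hg τ 0 = Hg τ 1 := fun τ hτ => by simp only [hHg, hloop τ hτ]
  have hHgne : ∀ τ ∈ Icc (0 : ℝ) 1, ∀ s ∈ Icc (0 : ℝ) 1, Hg τ s ≠ 0 := fun τ hτ s hs h0 =>
    hHP₀ τ hτ s hs ((crossRatioFn_eq_zero_iff (hHP₁ τ hτ s hs)).1 h0)
  /- the transported cut -/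
  set A : Set ℂ := (fun t => g (cut t)) '' Ico 0 1 with hA
  have hcutc : ContinuousOn (fun t => g (cut t)) (Ico 0 1) :=
    continuousOn_crossRatioFn.comp (hcut.mono Ico_subset_Icc_self) fun t ht => hcutP₁ t ht
  have hApre : IsPreconnected A := isPreconnected_Ico.image _ hcutc
  have h0A : (0 : ℂ) ∈ A := ⟨0, ⟨le_rfl, one_pos⟩, by
    show crossRatioFn P₀ P₁ (cut 0) = 0
    rw [hcut0, crossRatioFn_eq_zero_iff h01]⟩
  have hAb : ¬ IsBounded A := not_isBounded_image_crossRatioFn_cut h01 hcut hcut1 hcutP₁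
  have hAγ : A ⊆ (range fun t => g (Γ t))ᶜ := by
    rintro _ ⟨t, ht, rfl⟩ ⟨s, hs⟩
    have := crossRatioFn_injective h01 (hΓa s).2 (hcutP₁ t ht) hs
    exact hcutΓ t (Ico_subset_Icc_self ht) ⟨s, this⟩
  /- `wind (Γ' - P₀) = wind (Γ' - P₁)` -/
  have hw01 : wind (fun t => Γ' t - P₀) = wind (fun t => Γ' t - P₁) := by
    -- for `Γ`: `P₀, P₁` joined by `cut` off `Γ`
    have hsame : P₁ ∈ connectedComponentIn (range Γ)ᶜ P₀ := by
      have hsub : cut '' Icc 0 1 ⊆ (range Γ)ᶜ := by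
        rintro _ ⟨t, ht, rfl⟩
        exact hcutΓ t ht
      have := (isPreconnected_Icc.image cut hcut).subset_connectedComponentIn ⟨0, zero_mem_Icc01, hcut0⟩ hsub
      exact this ⟨1, one_mem_Icc01, hcut1⟩
    have hlog := hasLogOn_div_sub_of_mem_connectedComponentIn hΓ.isCompact_range.isClosed hsame
    have hΓ0 : wind (fun t => (Γ t - P₀) / (Γ t - P₁)) = 0 :=
      wind_comp_eq_zero_of_hasLogOn (F := fun z => (z - P₀) / (z - P₁)) hlog
        hΓ.continuous.continuousOn (fun t _ => mem_range_self t) hΓ.eq_zero_one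
    have hP₀r : P₀ ∉ range Γ := fun ⟨t, ht⟩ => (hΓa t).1 ht
    have hP₁r : P₁ ∉ range Γ := fun ⟨t, ht⟩ => (hΓa t).2 ht
    rw [wind_div (hΓ.isNonvanishingLoop_sub hP₀r) (hΓ.isNonvanishingLoop_sub hP₁r)] at hΓ0
    -- homotopy invariance for both points
    have hhom : ∀ {P : ℂ}, (∀ τ ∈ Icc (0 : ℝ) 1, ∀ s ∈ Icc (0 : ℝ) 1, H τ s ≠ P) →
        wind (fun t => Γ t - P) = wind (fun t => Γ' t - P) := by
      intro P hP
      have h := wind_eq_of_homotopy (H := fun τ s => H τ s - P) (hH.sub continuousOn_const)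
        (fun τ hτ => by simp only [hloop τ hτ]) fun τ hτ s hs => sub_ne_zero.2 (hP τ hτ s hs)
      change wind (fun s => H 0 s - P) = wind (fun s => H 1 s - P) at h
      rw [wind_congr (g := fun s => Γ s - P) fun s hs => by simp only [hH0 s hs],
        wind_congr (f := fun s => H 1 s - P) (g := fun s => Γ' s - P)
          fun s hs => by simp only [hH1 s hs]] at h
      exact h
    rw [← hhom hHP₀, ← hhom hHP₁]
    omega
  /- `λ` avoids `P₀`, `P₁`; the transported path lies inside `g ∘ Γ'` -/
  have hlamP : ∀ s ∈ Icc (0 : ℝ) 1, lam s ≠ P₀ ∧ lam s ≠ P₁ := fun s hs =>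
    ⟨fun h => hside s hs (by rw [h]), fun h => hside s hs (by rw [h, ← hw01])⟩
  have hlamg : ContinuousOn (fun s => g (lam s)) (Icc 0 1) :=
    continuousOn_crossRatioFn.comp hlam fun s hs => (hlamP s hs).2
  have hlamin : ∀ s ∈ Icc (0 : ℝ) 1, g (lam s) ∈ IsJordanLoop.inside fun t => g (Γ' t) := by
    intro s hs
    have hr : g (lam s) ∉ range fun t => g (Γ' t) := fun ⟨t, ht⟩ =>
      hlamΓ' s hs ⟨t, crossRatioFn_injective h01 (hΓ'a t).2 (hlamP s hs).2 ht⟩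
    rw [hγ'.mem_inside_iff_wind_ne_zero hr]
    show wind (fun t => crossRatioFn P₀ P₁ (Γ' t) - crossRatioFn P₀ P₁ (lam s)) ≠ 0
    rw [wind_crossRatioFn_sub h01 hΓ'.continuous.continuousOn hΓ'.eq_zero_one (fun t _ => (hΓ'a t).2)
      (hlamP s hs).2 fun t _ h => hlamΓ' s hs ⟨t, h⟩, ← hw01]
    exact sub_ne_zero.2 (hside s hs)
  /- the endpoints are unswept -/
  have hends : ∀ {e : ℝ}, e ∈ Icc (0 : ℝ) 1 → (∀ τ ∈ Icc (0 : ℝ) 1, ∀ s ∈ Icc (0 : ℝ) 1, H τ s ≠ lam e) →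
      ∀ τ ∈ Icc (0 : ℝ) 1, ∀ s ∈ Icc (0 : ℝ) 1, Hg τ s ≠ g (lam e) := by
    intro e he hHe τ hτ s hs h
    exact hHe τ hτ s hs (crossRatioFn_injective h01 (hHP₁ τ hτ s hs) (hlamP e he).2 h)
  /- the transported return path misses `A` -/
  have hnuP : ∀ s ∈ Icc (0 : ℝ) 1, nu s ≠ P₀ ∧ nu s ≠ P₁ := fun s hs =>
    ⟨hcut0 ▸ hnucut s hs 0 zero_mem_Icc01, hcut1 ▸ hnucut s hs 1 one_mem_Icc01⟩
  have hnug : ContinuousOn (fun s => g (nu s)) (Icc 0 1) :=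
    continuousOn_crossRatioFn.comp hnu fun s hs => (hnuP s hs).2
  have hnuA : ∀ s ∈ Icc (0 : ℝ) 1, g (nu s) ∉ A := by
    rintro s hs ⟨t, ht, hts⟩
    exact hnucut s hs t (Ico_subset_Icc_self ht) (crossRatioFn_injective h01 (hnuP s hs).2 (hcutP₁ t ht) hts.symm)
  /- apply the normalised theorem -/
  have key := even_wind_concatPath_of_loopHomotopy hγ hγ' hHgc hHg0 hHg1 hHgloop hHgne hApre h0A hAb
    hAγ hlamg hlamin (hends zero_mem_Icc01 hx) (hends one_mem_Icc01 hy) hnug (by simp only [hnu0]) (by simp only [hnu1]) hnuA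
  /- read it back through `g` -/
  have hcomp : concatPath (fun s => g (lam s)) (fun s => g (nu s)) = g ∘ concatPath lam nu :=
    (comp_concatPath g lam nu).symm
  rw [hcomp] at key
  set L := concatPath lam nu with hL
  have hLc : ContinuousOn L (Icc 0 1) := continuousOn_concatPath hlam hnu hnu0.symm
  have hL01 : L 0 = L 1 := by rw [hL, concatPath_zero, concatPath_one, hnu1]
  have hLP : MapsTo L (Icc 0 1) {z | z ≠ P₀ ∧ z ≠ P₁} := mapsTo_concatPath hlamP hnuP
  have hl0 : IsNonvanishingLoop fun t => L t - P₀ :=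
    ⟨hLc.sub continuousOn_const, fun t ht => sub_ne_zero.2 (hLP ht).1, by rw [hL01]⟩
  have hl1 : IsNonvanishingLoop fun t => L t - P₁ :=
    ⟨hLc.sub continuousOn_const, fun t ht => sub_ne_zero.2 (hLP ht).2, by rw [hL01]⟩
  have : wind (g ∘ L) = wind (fun t => L t - P₀) - wind (fun t => L t - P₁) := by
    rw [← wind_div hl0 hl1]
    rfl
  rw [← this]
  exact key

end Mobius

end Literature.Topology.PlaneTopology
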